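import Literature.Computability.Cryptography.QuantumTuringMachineLocalConditions
import Literature.Computability.Cryptography.QuantumTuringMachinePositionedFaithful
import Mathlib.LinearAlgebra.Matrix.Kronecker
import Mathlib.LinearAlgebra.UnitaryGroup
import Mathlib.Analysis.CStarAlgebra.Matrix
import Mathlib.Analysis.InnerProductSpace.Adjoint
import Mathlib.Data.ZMod.ValMinAbs
import HarnessLib

/-!
# Head-centred unitary simulation of a quantum Turing machine on a finite register (Yao 1993; Nishimura–Ozawa 2002, Thm. 4.3; Bernstein–Vazirani 1997, Lemma 5.5), in the tree's model

A.-C. Yao, *Quantum circuit complexity*, FOCS 1993, and H. Nishimura, M. Ozawa, *Computational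
complexity of uniform quantum circuit families and quantum Turing machines*, Theoret. Comput. Sci.
276 (2002) 147–181 = arXiv:quant-ph/9906095, Thm. 4.3: `t` steps of a QTM `M = (Q, Σ, δ)` are carried
out EXACTLY ("`t`-simulates", §4) by a unitary on the finite register "cell P" (the control state)
⊗ "cells `-t, …, t`" (the tape cells the machine can reach), namely `(K₂ ∘ K₁)^t`, where `K₁`
applies a fixed local gate `G₁` along the cells (`G₁ |w_{p,σ}⟩ = |v_{p,σ}⟩ :=
∑_{q,τ,d} δ(p,σ,q,τ,d) |q; …τ…; flag 2̄ on the cell moved to⟩`, condition (i); identity on the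
orthogonal rest, condition (ii); `G₁` EXISTS because the input space `W`, the output space `V` and
the rest `H` are mutually orthogonal by the well-formedness conditions, BV Thm. 5.3) and `K₂ = G₂`
resets the flags. This file proves the corresponding theorem for the TREE's model of QTMs
(`Literature.Computability.Cryptography.QTM`, prelude Q8), whose configurations `QTM.Cfg = (state,
Turing.Tape)` are Bernstein–Vazirani's configurations READ RELATIVE TO THE HEAD, i.e. modulo
translation, and whose evolution `QTM.evolve` therefore ADDS the amplitudes of translates (model
caveat of `QuantumComplexity/QuantumTuring.lean`; examples `ModelExamples.hadamardWalk`,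
`RotationWalk`). For this semantics the module docstring of `QuantumTuring.lean` (statement S04,
`BQPQTM = BQP`) records that the inclusion `BQPQTM ⊆ BQP` "for an arbitrary machine in the quotient
semantics is not covered by any source". The present file supplies the construction and its proof
at the level of finite-dimensional unitaries — the machine-independent core of that inclusion.

## The construction (head-centred coordinates)

In head-relative coordinates the tree's configurations ARE a computational basis and the head is
pinned at cell `0`, so ONE local gate per step suffices (instead of `2t - 1` overlapping copies of
`G₁`); the price is that the quotient dynamics forgets the direction of the move, which a unitary
cannot do locally: the direction bit has to be carried along and then ERASED coherently. The
erasure is exactly Bernstein–Vazirani's unidirection change of basis (SIAM J. Comput. 26 (1997),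
Lemma 5.5, p. 1435–1436): separability splits `ℂ^Q ⊇ C_L ⊕ C_R` orthogonally with every `d`-going
restricted superposition `δ(p, σ | τ, d)` in `C_d`, so after a step the direction is a function of
the (rotated) control state and can be uncomputed.

* Register `HC M N = Λ × (ZMod N → Γ) × Bool × Bool`: control state, a cyclic window of `N` tape
  cells around the head (`window`, cell `i` = head-relative position `i.valMinAbs`), the direction
  bit `d` (`false` = L) and a marker bit `e` (Nishimura–Ozawa's flags `0̄/1̄/2̄`, making input and
  output spaces of a step orthogonal). Codes of configurations: `encCfg c = (q, window T, L, 0)`.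
* `U_W` (`uW`, placed: `uWG`): the swap unitary (`swapUnitary Θ = Θ + Θᴴ + (1 - ΘᴴΘ - ΘΘᴴ)`, an
  explicit form of "there exists a quantum gate `G₁`") of the partial isometry
  `Θ_W |q, σ, L, 0⟩ = ∑ δ(q,σ,q',τ,d) |q', τ, d, 1⟩` on (state, cell `0`, `d`, `e`); unitary by unit
  length + orthogonality (`uW_mem_unitaryGroup`); entries are integer polynomials in the amplitudes
  and their conjugates.
* `U_S` (`uS`): the permutation shifting the window cyclically by `∓1` according to `d` (the head
  move; the wrap-around only moves blanks as long as the non-blank radius `r` has `2r + 1 ≤ N`,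
  `window_move_left/right`).
* `U_E` (`uE`, placed: `uEG`): the swap unitary of `Θ_E (v ⊗ |d,1⟩) = (P_d v) ⊗ |L,0⟩`, `P_d` the
  orthogonal projection onto `C_d` (`dirProj`, via Mathlib's `Submodule.starProjection`); unitary by
  separability (`C_L ⊥ C_R`, `dirSpace_isOrtho`, `uE_mem_unitaryGroup`); entries are entries of
  `P_L`, `P_R`.
* `hcStep M N = U_E · U_S · U_W`.

## Results (all `theorem`s; no named facts)

* `hcStep_mem_unitaryGroup` — unitary whenever `M` satisfies BV's three local conditions
  (`QTM.IsLocallyWellFormed`, file `…LocalConditions.lean`), i.e. (`isWellFormed_iff_isLocallyWellFormed`)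
  for every tree-well-formed machine over an alphabet with `≥ 2` symbols;
* `enc_evolve_single`, `enc_evolve` — ONE STEP: `enc (QTM.evolve ψ) = hcStep *ᵥ enc ψ` for
  superpositions of radius `r ≥ 1` and `N ≥ 2r + 3`, including the tree's merging of the update
  triples `(q', τ, L)` and `(q', τ, R)` that reach the same head-relative configuration (both are
  sent to the same code by the erasure stage);
* `enc_stateAt` — `t` STEPS: `enc (stateAt x t) = hcStep^t *ᵥ |encCfg (init x)⟩` for
  `N ≥ 2(|x| + t) + 3` (radius bookkeeping `blankBeyond_support_stateAt`);
* `acceptProbAt_eq_hcStep` — `QTM.acceptProbAt M x t` is the Born probability of the event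
  "state component = accept" in `hcStep^t |encCfg (init x)⟩`;
* one-symbol alphabets (where tree well-formedness is WEAKER than BV's conditions,
  `ModelExamples.halfHalf`): the state-marginal matrix `A = ∑_{τ,d} δ(·, ␣, ·, τ, d)` (`localSum`) is
  unitary iff `M` is tree-well-formed (`localSum_mem_unitaryGroup`, from `isWellFormed_iff_gram`), and
  `hcStep₁ = A ⊗ 1` simulates (`enc_stateAt₁`, `acceptProbAt_eq_hcStep₁`);
* `hcUnitary`, `hcUnitary_mem_unitaryGroup`, `acceptProbAt_eq_hcUnitary` — the two cases assembled:
  **for EVERY machine well formed in the tree's sense, every `x`, `t` and `N ≥ 2(|x|+t)+3`, the tree's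
  acceptance probability at time `t` is the Born probability of {state = accept} after `t`
  applications of ONE explicit unitary of the finite register `HC M N` to the basis vector
  `|encCfg (init x)⟩`.**

## What this is for, and what is not here

Towards `BQPQTM ⊆ BQP` for the tree's S04 (`QuantumComplexity/QuantumTuring.lean`) it remains to
(a) encode `HC M N` in qubits and `U_W`, `U_E` (fixed finite unitaries), `U_S` (a controlled cyclic
shift = `O(N)` controlled swaps) as words over a finite gate set `G_M ⊇` Clifford+T (Nishimura–Ozawa:
"`G₁` is decomposable by `O(1)` gates", "`G₂` … by `O(2t+1)` gates"), (b) prove polynomial-time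
uniformity of the family `n ↦ (step word)^{p(n)}`, (c) show that the entries of `U_W` (polynomials in
the amplitudes) and of `U_E` (entries of orthogonal projections onto spans of amplitude vectors,
hence rational in the amplitudes and their conjugates) are polynomial-time computable numbers when
the amplitudes are (`PolyTimeComputableReals*.lean` give the field operations), and (d) return to
Clifford+T by gate-set independence `BQPOver_eq_BQP` (Solovay–Kitaev; a named fact of `BQP.lean`).
None of (a)–(d) is in this file. Bernstein–Vazirani's positioned model (`…Positioned.lean`) is not
used: there the direction is recorded by the head position and Nishimura–Ozawa's construction
applies verbatim; the point here is the quotient semantics.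

## References

* H. Nishimura, M. Ozawa, *Computational complexity of uniform quantum circuit families and quantum
  Turing machines*, Theoret. Comput. Sci. 276 (2002) 147–181 = arXiv:quant-ph/9906095
  [NishimuraOzawa2002]: §4 (quantum circuits, `t`-simulation, encoding `e_t`), Thm. 4.3 and its proof
  (gates `G₁` with conditions (i), (ii), `G₂`, `K_G = (K₂ ∘ K₁)^t`) — read from the materialised
  arXiv text, pp. 11–13.
* A. C.-C. Yao, *Quantum circuit complexity*, Proc. 34th FOCS (1993) 352–361 [Yao1993] (the original
  simulation of `t` steps of a QTM by a circuit of size polynomial in `t`; as reported in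
  Nishimura–Ozawa §4).
* E. Bernstein, U. Vazirani, *Quantum complexity theory*, SIAM J. Comput. 26 (1997) 1411–1473
  [BernsteinVazirani1997SICOMP]: Def. 3.2 (QTM), Def. 5.2 (restricted superpositions), Thm. 5.3
  (unit length, orthogonality, separability), Lemma 5.4–5.5, pp. 1435–1436 (interleaving; the
  unidirection lemma and its change of basis `C_L ⊕ C_R`) — read from the materialised text.
-/

noncomputable section

namespace Literature.Computability.Cryptography

open Turing Matrix
open scoped BigOperators ComplexConjugate Kronecker

namespace QTM

/-! ### The swap unitary of a nilpotent partial isometry -/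

section swap

variable {n : Type*} [Fintype n] [DecidableEq n]

/-- **The swap unitary of a nilpotent partial isometry.** For a matrix `Θ` with `Θ Θᴴ Θ = Θ`
(a partial isometry, initial projection `Θᴴ Θ`, final projection `Θ Θᴴ`) and `Θ² = 0` (initial
and final spaces orthogonal), `Θ + Θᴴ + (1 − Θᴴ Θ − Θ Θᴴ)` is a self-adjoint unitary: it maps the
initial space onto the final space by `Θ`, back by `Θᴴ`, and fixes the common orthogonal
complement. This is the explicit form of the "quantum gate `G₁`" whose EXISTENCE Nishimura–Ozawa
infer from the orthogonality of the input space `W`, the output space `V` and the rest `H`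
(Theoret. Comput. Sci. 276 (2002), proof of Thm. 4.3: "the subspaces `W`, `V` and `H` are all
orthogonal one another … Thus, there exists a quantum gate `G₁`"); the explicit formula keeps the
entries polynomial in the entries of `Θ`. [folklore] -/
def swapUnitary (Θ : Matrix n n ℂ) : Matrix n n ℂ :=
  Θ + Θᴴ + (1 - Θᴴ * Θ - Θ * Θᴴ)

/-- The swap unitary is self-adjoint. [folklore] -/
theorem swapUnitary_conjTranspose (Θ : Matrix n n ℂ) : (swapUnitary Θ)ᴴ = swapUnitary Θ := by
  simp only [swapUnitary, conjTranspose_add, conjTranspose_sub, conjTranspose_mul,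
    conjTranspose_conjTranspose, conjTranspose_one]
  abel

/-- The swap unitary of a nilpotent partial isometry is an involution: `U² = 1` (expand; all mixed
products vanish by `Θ² = 0`, `Θ Θᴴ Θ = Θ`). [folklore] -/
theorem swapUnitary_mul_self {Θ : Matrix n n ℂ} (h1 : Θ * Θᴴ * Θ = Θ) (h2 : Θ * Θ = 0) :
    swapUnitary Θ * swapUnitary Θ = 1 := by
  have hA : Θᴴ * Θᴴ = 0 := by simpa only [conjTranspose_mul, conjTranspose_zero] using congrArg conjTranspose h2
  have hB : Θᴴ * (Θ * Θᴴ) = Θᴴ := by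
    simpa only [conjTranspose_mul, conjTranspose_conjTranspose, Matrix.mul_assoc] using congrArg conjTranspose h1
  have h1r : Θ * (Θᴴ * Θ) = Θ := by rw [← Matrix.mul_assoc, h1]
  have h2' : ∀ X : Matrix n n ℂ, Θ * (Θ * X) = 0 := fun X => by rw [← Matrix.mul_assoc, h2, Matrix.zero_mul]
  have hA' : ∀ X : Matrix n n ℂ, Θᴴ * (Θᴴ * X) = 0 := fun X => by rw [← Matrix.mul_assoc, hA, Matrix.zero_mul]
  simp only [swapUnitary, add_mul, mul_add, sub_mul, mul_sub, Matrix.one_mul, Matrix.mul_one,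
    Matrix.mul_assoc, h2, hA, h1r, hB, h2', hA', Matrix.mul_zero, sub_zero, add_zero]
  abel

/-- The swap unitary of a nilpotent partial isometry is unitary. [folklore] -/
theorem swapUnitary_mem_unitaryGroup {Θ : Matrix n n ℂ} (h1 : Θ * Θᴴ * Θ = Θ) (h2 : Θ * Θ = 0) :
    swapUnitary Θ ∈ Matrix.unitaryGroup n ℂ := by
  rw [Matrix.mem_unitaryGroup_iff, star_eq_conjTranspose, swapUnitary_conjTranspose,
    swapUnitary_mul_self h1 h2]

/-- On the initial space (`Θᴴ Θ x = x`) the swap unitary acts as `Θ` — Nishimura–Ozawa's condition (i)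
on `G₁`, `G₁ |w⟩ = |v⟩`. [cite: NishimuraOzawa2002, Thm. 4.3 (proof, condition (i))] -/
theorem swapUnitary_mulVec {Θ : Matrix n n ℂ} (h2 : Θ * Θ = 0) {x : n → ℂ}
    (hx : (Θᴴ * Θ) *ᵥ x = x) : swapUnitary Θ *ᵥ x = Θ *ᵥ x := by
  have hA : Θᴴ * Θᴴ = 0 := by simpa only [conjTranspose_mul, conjTranspose_zero] using congrArg conjTranspose h2
  have h3 : Θᴴ *ᵥ x = 0 := by
    rw [← hx, mulVec_mulVec, ← Matrix.mul_assoc, hA, Matrix.zero_mul, zero_mulVec]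
  have h4 : (Θ * Θᴴ) *ᵥ x = 0 := by rw [← mulVec_mulVec, h3, mulVec_zero]
  simp only [swapUnitary, add_mulVec, sub_mulVec, one_mulVec, h3, hx, h4, add_zero, sub_self]

end swap

/-! ### Placing a matrix on one tensor factor of a finite register -/

section lift

variable {X A B : Type*} [Fintype X] [DecidableEq X] [Fintype A] [DecidableEq A] [Fintype B]
  [DecidableEq B]

/-- A matrix `u` on the factor `A` of a register `X ≃ A × B`, extended by the identity on `B`
(`u ⊗ 1` transported along `π`): the placement of a gate on some components of a composite register
(Nishimura–Ozawa 2002, §4: "`G` is connected with cells `i₁, …, i_m`"). [cite: NishimuraOzawa2002, §4] -/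
def liftMat (π : X ≃ A × B) (u : Matrix A A ℂ) : Matrix X X ℂ :=
  Matrix.reindex π.symm π.symm (u ⊗ₖ (1 : Matrix B B ℂ))

omit [Fintype X] [DecidableEq X] [Fintype A] [DecidableEq A] [Fintype B] in
/-- Entries of a placed matrix: `u` on the `A`-components, Kronecker delta on the `B`-components. [folklore] -/
theorem liftMat_apply (π : X ≃ A × B) (u : Matrix A A ℂ) (x y : X) :
    liftMat π u x y = if (π x).2 = (π y).2 then u (π x).1 (π y).1 else 0 := by
  simp only [liftMat, reindex_apply, submatrix_apply, Equiv.symm_symm, kroneckerMap_apply, one_apply,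
    mul_ite, mul_one, mul_zero]

omit [DecidableEq X] [DecidableEq A] in
/-- Placement is multiplicative. [folklore] -/
theorem liftMat_mul (π : X ≃ A × B) (u v : Matrix A A ℂ) :
    liftMat π (u * v) = liftMat π u * liftMat π v := by
  simp only [liftMat, reindex_apply, Equiv.symm_symm]
  rw [submatrix_mul_equiv, ← mul_kronecker_mul, Matrix.mul_one]

omit [Fintype X] [Fintype A] [Fintype B] in
/-- Placement of the identity is the identity. [folklore] -/
theorem liftMat_one (π : X ≃ A × B) : liftMat π (1 : Matrix A A ℂ) = 1 := by
  simp only [liftMat, one_kronecker_one, reindex_apply, Equiv.symm_symm, submatrix_one_equiv]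

omit [Fintype X] [DecidableEq X] [Fintype A] [DecidableEq A] [Fintype B] in
/-- Placement commutes with the adjoint. [folklore] -/
theorem liftMat_conjTranspose (π : X ≃ A × B) (u : Matrix A A ℂ) :
    (liftMat π u)ᴴ = liftMat π uᴴ := by
  simp only [liftMat, reindex_apply, Equiv.symm_symm, conjTranspose_submatrix, conjTranspose_kronecker,
    conjTranspose_one]

/-- Placement of a unitary is unitary. [folklore] -/
theorem liftMat_mem_unitaryGroup (π : X ≃ A × B) {u : Matrix A A ℂ}
    (hu : u ∈ Matrix.unitaryGroup A ℂ) : liftMat π u ∈ Matrix.unitaryGroup X ℂ := by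
  rw [Matrix.mem_unitaryGroup_iff, star_eq_conjTranspose] at hu ⊢
  rw [liftMat_conjTranspose, ← liftMat_mul, hu, liftMat_one]

omit [DecidableEq X] [DecidableEq A] in
/-- The product vector `F ⊗ G` on a register `X ≃ A × B`: `y ↦ F (π y).1 · G (π y).2`. [folklore] -/
def prodVec (π : X ≃ A × B) (F : A → ℂ) (G : B → ℂ) : X → ℂ := fun y => F (π y).1 * G (π y).2

omit [Fintype X] [DecidableEq X] [Fintype A] [DecidableEq A] [Fintype B] [DecidableEq B] in
/-- Components of a product vector (definitional). [folklore] -/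
theorem prodVec_apply (π : X ≃ A × B) (F : A → ℂ) (G : B → ℂ) (y : X) :
    prodVec π F G y = F (π y).1 * G (π y).2 := rfl

omit [Fintype X] [Fintype A] [Fintype B] in
/-- A basis vector of `X ≃ A × B` is the product of the basis vectors of its components. [folklore] -/
theorem pi_single_eq_prodVec (π : X ≃ A × B) (x₀ : X) :
    (Pi.single x₀ (1 : ℂ) : X → ℂ) = prodVec π (Pi.single (π x₀).1 1) (Pi.single (π x₀).2 1) := by
  ext y
  simp only [prodVec, Pi.single_apply]
  by_cases hy : y = x₀
  · subst hy
    simp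
  · have hne : π y ≠ π x₀ := fun h' => hy (π.injective h')
    rw [if_neg hy]
    by_cases h1 : (π y).1 = (π x₀).1
    · have h2 : (π y).2 ≠ (π x₀).2 := fun h2 => hne (Prod.ext h1 h2)
      simp [h1, h2]
    · simp [h1]

omit [Fintype X] [Fintype B] in
/-- A product vector whose second factor is a basis vector, as a combination of basis vectors:
`F ⊗ |b₀⟩ = ∑ₐ F(a) |π⁻¹(a, b₀)⟩`. [folklore] -/
theorem prodVec_single_right (π : X ≃ A × B) (F : A → ℂ) (b₀ : B) :
    prodVec π F (Pi.single b₀ 1) = ∑ a, F a • (Pi.single (π.symm (a, b₀)) (1 : ℂ) : X → ℂ) := by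
  ext y
  simp only [prodVec_apply, Finset.sum_apply, Pi.smul_apply, Pi.single_apply, smul_eq_mul, mul_ite,
    mul_one, mul_zero]
  have key : ∀ a, (y = π.symm (a, b₀)) ↔ ((π y).1 = a ∧ (π y).2 = b₀) := fun a => by
    rw [Equiv.eq_symm_apply]
    exact Prod.ext_iff
  simp only [key, ite_and]
  rw [Finset.sum_ite_eq, if_pos (Finset.mem_univ _)]

omit [DecidableEq X] [DecidableEq A] in
/-- A placed matrix acts on product vectors through the first factor: `(u ⊗ 1)(f ⊗ g) = (u f) ⊗ g`. [folklore] -/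
theorem liftMat_mulVec_prod (π : X ≃ A × B) (u : Matrix A A ℂ) (f : A → ℂ) (g : B → ℂ) :
    liftMat π u *ᵥ (fun y => f (π y).1 * g (π y).2) = fun x => (u *ᵥ f) (π x).1 * g (π x).2 := by
  ext x
  have e₁ : (liftMat π u *ᵥ fun y => f (π y).1 * g (π y).2) x =
      ∑ y, liftMat π u x y * (f (π y).1 * g (π y).2) := rfl
  have e₂ : (u *ᵥ f) (π x).1 = ∑ a, u (π x).1 a * f a := rfl
  rw [e₁, e₂, ← Equiv.sum_comp π.symm, Fintype.sum_prod_type]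
  simp only [Equiv.apply_symm_apply]
  simp only [liftMat_apply π u, Equiv.apply_symm_apply, ite_mul, zero_mul, Finset.sum_ite_eq,
    Finset.mem_univ, if_true, Finset.sum_mul]
  exact Finset.sum_congr rfl fun a _ => by ring

omit [DecidableEq X] [DecidableEq A] in
/-- A placed matrix acts on product vectors through the first factor (`prodVec` form). [folklore] -/
theorem liftMat_mulVec_prodVec (π : X ≃ A × B) (u : Matrix A A ℂ) (F : A → ℂ) (G : B → ℂ) :
    liftMat π u *ᵥ prodVec π F G = prodVec π (u *ᵥ F) G :=
  liftMat_mulVec_prod π u F G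

end lift

/-! ### Blank radius and finite windows of a tape -/

section window

variable {Γ : Type} [Inhabited Γ]

/-- `BlankBeyond r T`: every cell of the (head-relative) tape `T` at distance `≥ r` from the head is
blank — the radius bookkeeping behind "the tape cells from cell `-t` to cell `t` after `t` steps"
(Nishimura–Ozawa 2002, §4, definition of `t`-simulation). [cite: NishimuraOzawa2002, §4] -/
def BlankBeyond (r : ℕ) (T : Tape Γ) : Prop :=
  ∀ j : ℤ, (r : ℤ) ≤ |j| → T.nth j = default

/-- A larger radius is a weaker condition. [folklore] -/
theorem BlankBeyond.mono {r r' : ℕ} {T : Tape Γ} (h : BlankBeyond r T) (hr : r ≤ r') :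
    BlankBeyond r' T :=
  fun j hj => h j (le_trans (by exact_mod_cast hr) hj)

/-- Writing the scanned cell does not change the radius (`r ≥ 1`). [folklore] -/
theorem BlankBeyond.write {r : ℕ} {T : Tape Γ} (h : BlankBeyond r T) (hr : 1 ≤ r) (b : Γ) :
    BlankBeyond r (T.write b) := by
  intro j hj
  rw [Tape.write_nth]
  have hj0 : j ≠ 0 := by
    rintro rfl
    simp only [abs_zero] at hj
    omega
  rw [if_neg hj0]
  exact h j hj

/-- Moving the head (to the left) increases the head-relative radius by at most one. [folklore] -/
theorem BlankBeyond.move_left {r : ℕ} {T : Tape Γ} (h : BlankBeyond r T) :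
    BlankBeyond (r + 1) (T.move Dir.left) := by
  intro j hj
  rw [Tape.move_left_nth]
  apply h
  have := abs_sub_abs_le_abs_sub j 1
  rw [abs_one] at this
  push_cast at hj
  linarith

/-- Moving the head (to the right) increases the head-relative radius by at most one. [folklore] -/
theorem BlankBeyond.move_right {r : ℕ} {T : Tape Γ} (h : BlankBeyond r T) :
    BlankBeyond (r + 1) (T.move Dir.right) := by
  intro j hj
  rw [Tape.move_right_nth]
  apply h
  have := abs_add_le (j + 1) (-1)
  rw [add_neg_cancel_right, abs_neg, abs_one] at this
  push_cast at hj
  linarith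

/-- Moving the head increases the head-relative radius by at most one. [folklore] -/
theorem BlankBeyond.move {r : ℕ} {T : Tape Γ} (h : BlankBeyond r T) (d : Dir) :
    BlankBeyond (r + 1) (T.move d) := by
  cases d
  exacts [h.move_left, h.move_right]

/-- The input tape `Tape.mk₁ l` (head on the first symbol of `l`) has radius `|l|`. [folklore] -/
theorem blankBeyond_mk₁ (l : List Γ) : BlankBeyond l.length (Tape.mk₁ l) := by
  intro j hj
  cases j with
  | ofNat m =>
    have hm : l.length ≤ m := by
      simp only [Int.ofNat_eq_natCast, Nat.abs_cast, Nat.cast_le] at hj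
      exact hj
    show (Tape.mk' (ListBlank.mk ([] : List Γ)) (ListBlank.mk l)).nth (m : ℕ) = default
    rw [Tape.mk'_nth_nat, ListBlank.nth_mk, List.getI_eq_default _ hm]
  | negSucc m =>
    show (ListBlank.mk ([] : List Γ)).nth m = default
    rw [ListBlank.nth_mk, List.getI_nil]

/-- The cyclic window of `N` cells around the head: cell `i : ZMod N` of the window holds the tape
symbol at head-relative position `i.valMinAbs ∈ (-N/2, N/2]` (cell `0` = the scanned cell). This is
Nishimura–Ozawa's block of `2t+1` cells (§4, proof of Thm. 4.3), read RELATIVE TO THE HEAD (the tree's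
configurations `QTM.Cfg` are head-relative) and closed up cyclically so that the head shift becomes a
permutation of a finite register. [cite: NishimuraOzawa2002, Thm. 4.3 (proof)] -/
def window (N : ℕ) (T : Tape Γ) (i : ZMod N) : Γ :=
  T.nth i.valMinAbs

/-- Window cell `0` is the scanned cell. [folklore] -/
@[simp] theorem window_zero (N : ℕ) (T : Tape Γ) : window N T 0 = T.head := by
  simp [window, ZMod.valMinAbs_zero]

/-- Writing the scanned symbol updates window cell `0`. [folklore] -/
theorem window_write (N : ℕ) (T : Tape Γ) (b : Γ) :
    window N (T.write b) = Function.update (window N T) 0 b := by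
  funext i
  simp only [window, Tape.write_nth, Function.update_apply, ZMod.valMinAbs_eq_zero]

/-- The window of the input tape `Tape.mk₁ l`: the symbols of `l` at the non-negative positions `< |l|`, blanks elsewhere. [folklore] -/
theorem window_mk₁ (N : ℕ) (l : List Γ) (i : ZMod N) :
    window N (Tape.mk₁ l) i = if 0 ≤ i.valMinAbs then l.getI i.valMinAbs.toNat else default := by
  unfold window
  rcases le_or_gt 0 i.valMinAbs with h | h
  · rw [if_pos h]
    obtain ⟨m, hm⟩ := Int.eq_ofNat_of_zero_le h
    rw [hm, Int.toNat_natCast]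
    show (Tape.mk' (ListBlank.mk ([] : List Γ)) (ListBlank.mk l)).nth (m : ℕ) = _
    rw [Tape.mk'_nth_nat, ListBlank.nth_mk]
  · rw [if_neg (not_le.2 h)]
    obtain ⟨k, hk⟩ := Int.eq_negSucc_of_lt_zero h
    rw [hk]
    show (ListBlank.mk ([] : List Γ)).nth k = default
    rw [ListBlank.nth_mk, List.getI_nil]

variable {N : ℕ} [NeZero N]

/-- `valMinAbs (i - 1)` is `valMinAbs i - 1`, except at the left end of the window where it wraps
around by `+N`. [folklore] -/
theorem valMinAbs_sub_one (i : ZMod N) :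
    (i - 1).valMinAbs = i.valMinAbs - 1 ∨
      ((i - 1).valMinAbs = i.valMinAbs - 1 + N ∧ (i.valMinAbs - 1) * 2 ≤ -(N : ℤ)) := by
  have hi := i.valMinAbs_mem_Ioc
  by_cases hc : -(N : ℤ) < (i.valMinAbs - 1) * 2
  · left
    rw [ZMod.valMinAbs_spec]
    refine ⟨by simp [ZMod.coe_valMinAbs], hc, by linarith [hi.2]⟩
  · right
    push Not at hc
    refine ⟨?_, hc⟩
    rw [ZMod.valMinAbs_spec]
    refine ⟨by simp [ZMod.coe_valMinAbs], ?_, by linarith⟩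
    have h1 : (0 : ℤ) < N := by exact_mod_cast Nat.pos_of_ne_zero (NeZero.ne N)
    linarith [hi.1]

/-- `valMinAbs (i + 1)` is `valMinAbs i + 1`, except at the right end of the window where it wraps
around by `-N`. [folklore] -/
theorem valMinAbs_add_one (i : ZMod N) :
    (i + 1).valMinAbs = i.valMinAbs + 1 ∨
      ((i + 1).valMinAbs = i.valMinAbs + 1 - N ∧ (N : ℤ) < (i.valMinAbs + 1) * 2) := by
  have hi := i.valMinAbs_mem_Ioc
  by_cases hc : (i.valMinAbs + 1) * 2 ≤ (N : ℤ)
  · left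
    rw [ZMod.valMinAbs_spec]
    refine ⟨by simp [ZMod.coe_valMinAbs], by linarith [hi.1], hc⟩
  · right
    push Not at hc
    refine ⟨?_, hc⟩
    rw [ZMod.valMinAbs_spec]
    refine ⟨by simp [ZMod.coe_valMinAbs], by linarith, ?_⟩
    have h1 : (0 : ℤ) < N := by exact_mod_cast Nat.pos_of_ne_zero (NeZero.ne N)
    linarith [hi.2]

/-- **The head moving left is a cyclic shift of the window** (new cell `i` = old cell `i - 1`) as long
as the non-blank part has radius `r` with `2r + 1 ≤ N` (the wrap-around only moves blanks). [folklore] -/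
theorem window_move_left {r : ℕ} {T : Tape Γ} (h : BlankBeyond r T) (hN : 2 * r + 1 ≤ N) :
    window N (T.move Dir.left) = fun i => window N T (i - 1) := by
  funext i
  simp only [window, Tape.move_left_nth]
  rcases valMinAbs_sub_one i with h1 | ⟨h1, h2⟩
  · rw [h1]
  · rw [h1]
    have hi := i.valMinAbs_mem_Ioc
    have hN' : (2 * r + 1 : ℤ) ≤ N := by exact_mod_cast hN
    rw [h _ ?_, h _ ?_]
    · rw [le_abs]
      left
      linarith [hi.1]
    · rw [le_abs]
      right
      linarith

/-- **The head moving right is a cyclic shift of the window** (new cell `i` = old cell `i + 1`) when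
`2r + 1 ≤ N`. [folklore] -/
theorem window_move_right {r : ℕ} {T : Tape Γ} (h : BlankBeyond r T) (hN : 2 * r + 1 ≤ N) :
    window N (T.move Dir.right) = fun i => window N T (i + 1) := by
  funext i
  simp only [window, Tape.move_right_nth]
  rcases valMinAbs_add_one i with h1 | ⟨h1, h2⟩
  · rw [h1]
  · rw [h1]
    have hi := i.valMinAbs_mem_Ioc
    have hN' : (2 * r + 1 : ℤ) ≤ N := by exact_mod_cast hN
    rw [h _ ?_, h _ ?_]
    · rw [le_abs]
      right
      linarith [hi.2]
    · rw [le_abs]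
      left
      linarith

/-- Both head moves as ONE formula: new cell `i` = old cell `i + (±1)`, `+1` for a right move
(`e = true`), `-1` for a left move (`e = false`; `dirOfBool`). [folklore] -/
theorem window_move {r : ℕ} {T : Tape Γ} (h : BlankBeyond r T) (hN : 2 * r + 1 ≤ N) (e : Bool) :
    window N (T.move (dirOfBool e)) = fun i => window N T (i + (if e then 1 else -1)) := by
  cases e
  · simpa [sub_eq_add_neg] using window_move_left h hN
  · simpa using window_move_right h hN

/-- Within radius the tape is read off its window; outside it is blank. [folklore] -/
theorem nth_eq_window {r : ℕ} {T : Tape Γ} (h : BlankBeyond r T) (hN : 2 * r + 1 ≤ N) (j : ℤ) :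
    T.nth j = if |j| < r then window N T (j : ZMod N) else default := by
  split_ifs with hj
  · unfold window
    congr 1
    symm
    rw [ZMod.valMinAbs_spec]
    have hN' : (2 * r + 1 : ℤ) ≤ N := by exact_mod_cast hN
    rw [abs_lt] at hj
    exact ⟨rfl, by linarith [hj.1], by linarith [hj.2]⟩
  · exact h j (not_lt.1 hj)

/-- **Faithfulness of windows**: tapes of radius `r`, `2r + 1 ≤ N`, with equal windows are equal. [folklore] -/
theorem eq_of_window_eq {r : ℕ} {T₁ T₂ : Tape Γ} (h₁ : BlankBeyond r T₁) (h₂ : BlankBeyond r T₂)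
    (hN : 2 * r + 1 ≤ N) (hw : window N T₁ = window N T₂) : T₁ = T₂ :=
  tape_ext_nth fun j => by rw [nth_eq_window h₁ hN, nth_eq_window h₂ hN, hw]

end window

/-! ### The local step unitary `U_W` -/

section local_step

variable (M : QTM)

/-- The local register `(q, σ, d, e)`: control state, scanned symbol, direction bit `d` (`false` = L,
`true` = R, as `dirOfBool`) and marker bit `e`. The marker plays the role of Nishimura–Ozawa's cell
flags `0̄, 1̄, 2̄` (proof of Thm. 4.3): inputs of a step carry `e = false`, outputs `e = true`, which
makes input and output spaces orthogonal. [cite: NishimuraOzawa2002, Thm. 4.3 (proof)] -/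
abbrev Loc : Type := M.Λ × M.Γ × Bool × Bool

/-- The erasure register `(q, d, e)`: control state, direction bit, marker bit — the support of the
direction-erasing change of basis (Bernstein–Vazirani 1997, Lemma 5.5). [cite: BernsteinVazirani1997SICOMP, Lemma 5.5] -/
abbrev Er : Type := M.Λ × Bool × Bool

/-- **The local transition as a partial isometry** `Θ_W` on the local register:
`Θ_W |q, σ, L, 0⟩ = ∑_{q', τ, d} δ(q, σ, q', τ, d) |q', τ, d, 1⟩` and `Θ_W = 0` on all other basis
vectors — Nishimura–Ozawa's `|w_{p,σ}⟩ ↦ |v_{p,σ}⟩` (proof of Thm. 4.3, condition (i) on `G₁`,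
with the head pinned at the middle cell and the written direction kept in the bit `d` instead of a
neighbouring cell's flag `2̄`). Entries are transition amplitudes of `M` or `0`. [cite: NishimuraOzawa2002, Thm. 4.3 (proof)] -/
def thetaW : Matrix M.Loc M.Loc ℂ := Matrix.of fun x y =>
  if y.2.2.1 = false ∧ y.2.2.2 = false ∧ x.2.2.2 = true then
    M.δ y.1 y.2.1 x.1 x.2.1 (dirOfBool x.2.2.1) else 0

/-- The projection onto the input space `span{|q, σ, L, 0⟩}` of the local register (a 0/1 diagonal matrix). [folklore] -/
def projIn : Matrix M.Loc M.Loc ℂ := Matrix.of fun y y' =>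
  if y = y' ∧ y.2.2.1 = false ∧ y.2.2.2 = false then 1 else 0

/-- **The local step unitary `U_W`** := the swap unitary of `Θ_W`: Nishimura–Ozawa's gate `G₁`, made
explicit (entries: integer polynomials in the amplitudes of `M` and their conjugates). It is unitary
when `M` satisfies unit length and orthogonality (`uW_mem_unitaryGroup`). [cite: NishimuraOzawa2002, Thm. 4.3 (proof, gate G₁)] -/
def uW : Matrix M.Loc M.Loc ℂ := swapUnitary M.thetaW

/-- Entries of `Θ_W` (definitional). [folklore] -/
theorem thetaW_apply (x y : M.Loc) : M.thetaW x y =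
    if y.2.2.1 = false ∧ y.2.2.2 = false ∧ x.2.2.2 = true then
      M.δ y.1 y.2.1 x.1 x.2.1 (dirOfBool x.2.2.1) else 0 := rfl

/-- Summation over the local register, component by component. [folklore] -/
theorem sum_loc (F : M.Loc → ℂ) :
    ∑ x : M.Loc, F x = ∑ q : M.Λ, ∑ τ : M.Γ, ∑ d : Bool, ∑ e : Bool, F (q, τ, d, e) := by
  simp only [Fintype.sum_prod_type]

/-- `Θ_W² = 0`: outputs carry the marker `e = 1`, inputs `e = 0`. [folklore] -/
theorem thetaW_mul_self : M.thetaW * M.thetaW = 0 := by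
  ext x z
  simp only [mul_apply, thetaW_apply, Matrix.zero_apply]
  refine Finset.sum_eq_zero fun y _ => ?_
  rcases Bool.eq_false_or_eq_true y.2.2.2 with hy | hy <;> simp [hy]

/-- **Unit length and orthogonality make `Θ_W` an isometry on the input space**:
`Θ_Wᴴ Θ_W = P_in`, the Gram matrix of the update superpositions `δ(p, σ)` being the identity
(Bernstein–Vazirani 1997, Thm. 5.3, first two conditions; Nishimura–Ozawa: "`{|v_{p,σ,σ₁,σ₃}⟩}` is an
orthonormal system"). [cite: BernsteinVazirani1997SICOMP, Thm. 5.3] -/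
theorem thetaW_conjTranspose_mul_self (h : M.IsLocallyWellFormed) :
    M.thetaWᴴ * M.thetaW = M.projIn := by
  ext y y'
  simp only [mul_apply, conjTranspose_apply, thetaW_apply, projIn, of_apply]
  by_cases hy : y.2.2.1 = false ∧ y.2.2.2 = false
  · by_cases hy' : y'.2.2.1 = false ∧ y'.2.2.2 = false
    · have key : ∑ x : M.Loc, star (M.thetaW x y) * M.thetaW x y' =
          conj (M.updateInner y.1 y.2.1 y'.1 y'.2.1) := by
        rw [sum_loc]
        simp only [thetaW_apply, hy, hy', true_and, Fintype.sum_bool, if_true, dirOfBool_true,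
          dirOfBool_false, updateInner, map_sum, map_add, map_mul, Complex.conj_conj,
          Bool.false_eq_true, if_false, RCLike.star_def]
        refine Finset.sum_congr rfl fun q _ => Finset.sum_congr rfl fun τ _ => ?_
        ring
      simp only [thetaW_apply] at key
      rw [key]
      by_cases hqq : (y.1, y.2.1) = (y'.1, y'.2.1)
      · have hyy : y = y' := by
          obtain ⟨q, σ, d, e⟩ := y
          obtain ⟨q', σ', d', e'⟩ := y'
          simp only [Prod.mk.injEq] at hqq hy hy' ⊢
          exact ⟨hqq.1, hqq.2, by rw [hy.1, hy'.1], by rw [hy.2, hy'.2]⟩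
        subst hyy
        rw [updateInner_self, h.unit_length]
        simp [hy]
      · rw [h.orthogonality _ _ _ _ hqq, map_zero]
        have hyy : y ≠ y' := by
          rintro rfl
          exact hqq rfl
        simp [hyy]
    · have hyy : ¬ (y = y' ∧ y.2.2.1 = false ∧ y.2.2.2 = false) := by
        rintro ⟨rfl, h1, h2⟩
        exact hy' ⟨h1, h2⟩
      rw [if_neg hyy]
      refine Finset.sum_eq_zero fun x _ => ?_
      have : ¬ (y'.2.2.1 = false ∧ y'.2.2.2 = false ∧ x.2.2.2 = true) := fun h' => hy' ⟨h'.1, h'.2.1⟩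
      rw [if_neg this, mul_zero]
  · have hyy : ¬ (y = y' ∧ y.2.2.1 = false ∧ y.2.2.2 = false) := fun h' => hy h'.2
    rw [if_neg hyy]
    refine Finset.sum_eq_zero fun x _ => ?_
    have : ¬ (y.2.2.1 = false ∧ y.2.2.2 = false ∧ x.2.2.2 = true) := fun h' => hy ⟨h'.1, h'.2.1⟩
    rw [if_neg this, star_zero, zero_mul]

/-- `Θ_W` vanishes off the input space: `Θ_W P_in = Θ_W`. [folklore] -/
theorem thetaW_mul_projIn : M.thetaW * M.projIn = M.thetaW := by
  ext x y'
  simp only [mul_apply, projIn, of_apply, mul_ite, mul_one, mul_zero]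
  rw [Finset.sum_eq_single y']
  · by_cases hy' : y'.2.2.1 = false ∧ y'.2.2.2 = false
    · simp [hy']
    · rw [if_neg (fun h' => hy' h'.2), thetaW_apply, if_neg (fun h' => hy' ⟨h'.1, h'.2.1⟩)]
  · intro y _ hne
    rw [if_neg (fun h' => hne h'.1)]
  · intro h'
    exact absurd (Finset.mem_univ _) h'

/-- `Θ_W` is a partial isometry, `Θ_W Θ_Wᴴ Θ_W = Θ_W`, under unit length and orthogonality. [cite: BernsteinVazirani1997SICOMP, Thm. 5.3] -/
theorem thetaW_partialIsometry (h : M.IsLocallyWellFormed) :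
    M.thetaW * M.thetaWᴴ * M.thetaW = M.thetaW := by
  rw [Matrix.mul_assoc, thetaW_conjTranspose_mul_self M h, thetaW_mul_projIn]

/-- **`U_W` is unitary** for machines satisfying Bernstein–Vazirani's local conditions (only unit
length and orthogonality are used). [cite: NishimuraOzawa2002, Thm. 4.3 (proof, existence of G₁)] -/
theorem uW_mem_unitaryGroup (h : M.IsLocallyWellFormed) : M.uW ∈ Matrix.unitaryGroup M.Loc ℂ :=
  swapUnitary_mem_unitaryGroup (M.thetaW_partialIsometry h) M.thetaW_mul_self

/-- `U_W` is self-adjoint (so the gate set `{U_W}` is closed under inverses). [folklore] -/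
theorem uW_conjTranspose : M.uWᴴ = M.uW := swapUnitary_conjTranspose _

/-- `U_W` is an involution. [folklore] -/
theorem uW_mul_self (h : M.IsLocallyWellFormed) : M.uW * M.uW = 1 :=
  swapUnitary_mul_self (M.thetaW_partialIsometry h) M.thetaW_mul_self

/-- **`U_W` carries out the local transition**: `U_W |q, σ, L, 0⟩ = ∑_{q',τ,d} δ(q,σ,q',τ,d) |q',τ,d,1⟩`
(Nishimura–Ozawa's condition (i), `G₁|w_{p,σ}⟩ = |v_{p,σ}⟩`). [cite: NishimuraOzawa2002, Thm. 4.3 (proof, condition (i))] -/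
theorem uW_mulVec_single (h : M.IsLocallyWellFormed) (q : M.Λ) (σ : M.Γ) :
    M.uW *ᵥ Pi.single (q, σ, false, false) 1 =
      fun x => if x.2.2.2 = true then M.δ q σ x.1 x.2.1 (dirOfBool x.2.2.1) else 0 := by
  unfold uW
  rw [swapUnitary_mulVec M.thetaW_mul_self]
  · ext x
    rw [mulVec_single_one, col_apply, thetaW_apply]
    simp
  · rw [thetaW_conjTranspose_mul_self M h, mulVec_single_one]
    ext x
    simp only [col_apply, projIn, of_apply, Pi.single_apply]
    by_cases hx : x = (q, σ, false, false)
    · subst hx; simp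
    · simp [hx]

end local_step

/-! ### Direction subspaces, their projections, and the erasure unitary `U_E` -/

section erase

variable (M : QTM)

/-- The restricted superposition `δ(p, σ | τ, d) = ∑_q δ(p, σ, τ, q, d) |q⟩ ∈ ℂ^Q`
(Bernstein–Vazirani 1997, Def. 5.2), direction as a bit. [cite: BernsteinVazirani1997SICOMP, Def. 5.2] -/
def resVec (p : M.Λ) (σ τ : M.Γ) (e : Bool) : M.Λ → ℂ := fun q => M.δ p σ q τ (dirOfBool e)

/-- Bernstein–Vazirani's direction subspaces `C_L`, `C_R ⊆ ℂ^Q`: the span of the `d`-going restricted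
superpositions (proof of Lemma 5.5: "we can split `ℂ^Q` into mutually orthogonal subspaces `C_L` and
`C_R` such that … `δ(p₁, σ₁ | τ₁, d) ∈ C_d`"; we take the spans themselves, which are orthogonal by
separability, `dirSpace_isOrtho`). [cite: BernsteinVazirani1997SICOMP, Lemma 5.5 (proof)] -/
def dirSpace (e : Bool) : Submodule ℂ (EuclideanSpace ℂ M.Λ) :=
  Submodule.span ℂ (Set.range fun x : M.Λ × M.Γ × M.Γ =>
    (WithLp.toLp 2 (M.resVec x.1 x.2.1 x.2.2 e) : EuclideanSpace ℂ M.Λ))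

/-- The orthogonal projection `P_d` of `ℂ^Q` onto the direction subspace `C_d`, as a matrix
(the basis-free form of Bernstein–Vazirani's choice of orthonormal bases `B_L`, `B_R` of `C_L`, `C_R`).
[cite: BernsteinVazirani1997SICOMP, Lemma 5.5 (proof)] -/
def dirProj (e : Bool) : Matrix M.Λ M.Λ ℂ :=
  (Matrix.toEuclideanCLM (n := M.Λ) (𝕜 := ℂ)).symm (M.dirSpace e).starProjection

/-- `P_d` is the matrix of the orthogonal projection onto `C_d`. [folklore] -/
theorem toEuclideanCLM_dirProj (e : Bool) :
    Matrix.toEuclideanCLM (n := M.Λ) (𝕜 := ℂ) (M.dirProj e) = (M.dirSpace e).starProjection := by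
  unfold dirProj
  exact (Matrix.toEuclideanCLM (n := M.Λ) (𝕜 := ℂ)).apply_symm_apply _

/-- `P_d` is idempotent. [folklore] -/
theorem dirProj_mul_self (e : Bool) : M.dirProj e * M.dirProj e = M.dirProj e := by
  unfold dirProj
  rw [← map_mul, (M.dirSpace e).isIdempotentElem_starProjection.eq]

/-- `P_d` is self-adjoint. [folklore] -/
theorem dirProj_conjTranspose (e : Bool) : (M.dirProj e)ᴴ = M.dirProj e := by
  rw [← star_eq_conjTranspose]
  unfold dirProj
  rw [← map_star, (isSelfAdjoint_starProjection (M.dirSpace e)).star_eq]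

/-- `P_d` fixes the `d`-going restricted superpositions (they span `C_d`). [cite: BernsteinVazirani1997SICOMP, Lemma 5.5 (proof)] -/
theorem dirProj_mulVec_resVec (p : M.Λ) (σ τ : M.Γ) (e : Bool) :
    M.dirProj e *ᵥ M.resVec p σ τ e = M.resVec p σ τ e := by
  have hmem : (WithLp.toLp 2 (M.resVec p σ τ e) : EuclideanSpace ℂ M.Λ) ∈ M.dirSpace e :=
    Submodule.subset_span ⟨(p, σ, τ), rfl⟩
  have h1 := Submodule.starProjection_eq_self_iff.2 hmem
  rw [← toEuclideanCLM_dirProj, Matrix.toEuclideanCLM_toLp] at h1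
  exact (WithLp.toLp_injective 2) h1

/-- **Separability is `C_L ⊥ C_R`** (Bernstein–Vazirani 1997, proof of Lemma 5.5: "The separability
condition says that … This means that we can split `ℂ^Q` into mutually orthogonal subspaces").
[cite: BernsteinVazirani1997SICOMP, Lemma 5.5 (proof)] -/
theorem dirSpace_isOrtho (h : M.IsLocallyWellFormed) : M.dirSpace false ⟂ M.dirSpace true := by
  rw [dirSpace, dirSpace, Submodule.isOrtho_span]
  rintro _ ⟨x, rfl⟩ _ ⟨y, rfl⟩
  rw [EuclideanSpace.inner_toLp_toLp]
  have hsep := h.separability x.1 x.2.1 x.2.2 y.1 y.2.1 y.2.2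
  have h2 : conj (M.restrictedInner x.1 x.2.1 x.2.2 Dir.left y.1 y.2.1 y.2.2 Dir.right) = 0 := by
    rw [hsep, map_zero]
  unfold restrictedInner at h2
  rw [map_sum] at h2
  rw [← h2]
  simp only [dotProduct, Pi.star_apply, RCLike.star_def, resVec, dirOfBool_false, dirOfBool_true,
    map_mul, Complex.conj_conj]
  exact Finset.sum_congr rfl fun q _ => by ring

/-- Separability gives `P_L P_R = 0 = P_R P_L`. [cite: BernsteinVazirani1997SICOMP, Lemma 5.5 (proof)] -/
theorem dirProj_mul_dirProj_of_ne (h : M.IsLocallyWellFormed) {e e' : Bool} (hne : e ≠ e') :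
    M.dirProj e * M.dirProj e' = 0 := by
  have key : (M.dirSpace e).starProjection * (M.dirSpace e').starProjection = 0 := by
    rw [ContinuousLinearMap.mul_def]
    cases e <;> cases e'
    · exact absurd rfl hne
    · exact (M.dirSpace_isOrtho h).starProjection_comp_starProjection
    · exact (M.dirSpace_isOrtho h).symm.starProjection_comp_starProjection
    · exact absurd rfl hne
  unfold dirProj
  rw [← map_mul, key, map_zero]

/-- **Direction erasure as a partial isometry** `Θ_E` on the erasure register:
`Θ_E (v ⊗ |d, 1⟩) = (P_d v) ⊗ |L, 0⟩`, zero elsewhere. On the vectors that actually occur after a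
step — `v ∈ C_d` tagged with their own direction `d` — it forgets `d` and resets the marker; this is
the coherent version of Bernstein–Vazirani's observation that after the change of basis to
`B_L ∪ B_R` "any state … can be entered while traveling in only one direction", i.e. the direction
is a function of the new basis state and can be uncomputed (Lemma 5.5). In the head-relative model
the direction is recorded nowhere else, so it MUST be erased for paths to interfere as in `QTM.evolve`.
[cite: BernsteinVazirani1997SICOMP, Lemma 5.5] -/
def thetaE : Matrix M.Er M.Er ℂ := Matrix.of fun x y =>
  if y.2.2 = true ∧ x.2.2 = false ∧ x.2.1 = false then M.dirProj y.2.1 x.1 y.1 else 0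

/-- **The erasure unitary `U_E`** := the swap unitary of `Θ_E` (entries: entries of `P_L`, `P_R`, i.e.
rational functions of the amplitudes and their conjugates). Unitary under separability
(`uE_mem_unitaryGroup`). [cite: BernsteinVazirani1997SICOMP, Lemma 5.5] -/
def uE : Matrix M.Er M.Er ℂ := swapUnitary M.thetaE

/-- Entries of `Θ_E` (definitional). [folklore] -/
theorem thetaE_apply (x y : M.Er) : M.thetaE x y =
    if y.2.2 = true ∧ x.2.2 = false ∧ x.2.1 = false then M.dirProj y.2.1 x.1 y.1 else 0 := rfl

/-- Summation over the erasure register, component by component. [folklore] -/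
theorem sum_er (F : M.Er → ℂ) :
    ∑ x : M.Er, F x = ∑ q : M.Λ, ∑ d : Bool, ∑ e : Bool, F (q, d, e) := by
  simp only [Fintype.sum_prod_type]

/-- `Θ_E² = 0`: inputs carry the marker `1`, outputs `0`. [folklore] -/
theorem thetaE_mul_self : M.thetaE * M.thetaE = 0 := by
  ext x z
  simp only [mul_apply, thetaE_apply, Matrix.zero_apply]
  refine Finset.sum_eq_zero fun y _ => ?_
  rcases Bool.eq_false_or_eq_true y.2.2 with hy | hy <;> simp [hy]

/-- The initial projection of `Θ_E`: `P_L ⊗ |L,1⟩⟨L,1| + P_R ⊗ |R,1⟩⟨R,1|` (as a matrix). [folklore] -/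
def gramE : Matrix M.Er M.Er ℂ := Matrix.of fun y y' =>
  if y.2.2 = true ∧ y'.2.2 = true ∧ y.2.1 = y'.2.1 then M.dirProj y.2.1 y.1 y'.1 else 0

/-- `Θ_Eᴴ Θ_E = P_L ⊗ |L,1⟩⟨L,1| + P_R ⊗ |R,1⟩⟨R,1|` — the cross terms are `P_L P_R = 0` by
separability. [cite: BernsteinVazirani1997SICOMP, Lemma 5.5 (proof)] -/
theorem thetaE_conjTranspose_mul_self (h : M.IsLocallyWellFormed) :
    M.thetaEᴴ * M.thetaE = M.gramE := by
  ext y y'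
  simp only [mul_apply, conjTranspose_apply, gramE, of_apply]
  by_cases hy : y.2.2 = true
  · by_cases hy' : y'.2.2 = true
    · have key : ∑ x : M.Er, star (M.thetaE x y) * M.thetaE x y' =
          (M.dirProj y.2.1 * M.dirProj y'.2.1) y.1 y'.1 := by
        rw [sum_er, mul_apply]
        conv_rhs => rw [← dirProj_conjTranspose]
        simp only [thetaE_apply, hy, hy', true_and, Fintype.sum_bool, Bool.true_eq_false, and_false,
          if_false, star_zero, zero_mul, add_zero, zero_add, and_true, if_true, conjTranspose_apply]
      rw [key]
      simp only [hy, hy', true_and]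
      by_cases hd : y.2.1 = y'.2.1
      · rw [if_pos hd, hd, dirProj_mul_self]
      · rw [if_neg hd, dirProj_mul_dirProj_of_ne M h hd, Matrix.zero_apply]
    · have hyy : ¬ (y.2.2 = true ∧ y'.2.2 = true ∧ y.2.1 = y'.2.1) := fun h' => hy' h'.2.1
      rw [if_neg hyy]
      refine Finset.sum_eq_zero fun x _ => ?_
      rw [thetaE_apply M x y', if_neg (fun h' => hy' h'.1), mul_zero]
  · have hyy : ¬ (y.2.2 = true ∧ y'.2.2 = true ∧ y.2.1 = y'.2.1) := fun h' => hy h'.1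
    rw [if_neg hyy]
    refine Finset.sum_eq_zero fun x _ => ?_
    rw [thetaE_apply M x y, if_neg (fun h' => hy h'.1), star_zero, zero_mul]

/-- `Θ_E` vanishes off its initial space: `Θ_E (Θ_Eᴴ Θ_E) = Θ_E` given the block form of `Θ_Eᴴ Θ_E`. [folklore] -/
theorem thetaE_mul_gramE : M.thetaE * M.gramE = M.thetaE := by
  ext x y'
  rw [mul_apply, sum_er]
  by_cases hc : y'.2.2 = true ∧ x.2.2 = false ∧ x.2.1 = false
  · have key : ∑ q : M.Λ, ∑ d : Bool, ∑ e : Bool, M.thetaE x (q, d, e) * M.gramE (q, d, e) y' =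
        (M.dirProj y'.2.1 * M.dirProj y'.2.1) x.1 y'.1 := by
      rw [mul_apply]
      refine Finset.sum_congr rfl fun q _ => ?_
      simp only [thetaE_apply, gramE, of_apply, hc, true_and, and_true, Fintype.sum_bool, if_true,
        Bool.false_eq_true, if_false, false_and, zero_mul, add_zero]
      rcases Bool.eq_false_or_eq_true y'.2.1 with hd | hd <;> simp [hd]
    rw [key, dirProj_mul_self, thetaE_apply, if_pos hc]
  · rw [thetaE_apply M x y', if_neg hc]
    refine Finset.sum_eq_zero fun q _ => Finset.sum_eq_zero fun d _ => Finset.sum_eq_zero fun e _ => ?_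
    simp only [thetaE_apply, gramE, of_apply]
    by_cases h1 : e = true ∧ x.2.2 = false ∧ x.2.1 = false
    · rw [if_pos h1]
      by_cases h2 : e = true ∧ y'.2.2 = true ∧ d = y'.2.1
      · exact absurd ⟨h2.2.1, h1.2⟩ hc
      · rw [if_neg (by simpa using h2), mul_zero]
    · rw [if_neg (by simpa using h1), zero_mul]

/-- `Θ_E` is a partial isometry under separability. [cite: BernsteinVazirani1997SICOMP, Lemma 5.5 (proof)] -/
theorem thetaE_partialIsometry (h : M.IsLocallyWellFormed) :
    M.thetaE * M.thetaEᴴ * M.thetaE = M.thetaE := by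
  rw [Matrix.mul_assoc, thetaE_conjTranspose_mul_self M h, thetaE_mul_gramE]

/-- **`U_E` is unitary** for machines satisfying the local conditions (separability is used here). [cite: BernsteinVazirani1997SICOMP, Lemma 5.5] -/
theorem uE_mem_unitaryGroup (h : M.IsLocallyWellFormed) : M.uE ∈ Matrix.unitaryGroup M.Er ℂ :=
  swapUnitary_mem_unitaryGroup (M.thetaE_partialIsometry h) M.thetaE_mul_self

/-- `U_E` is self-adjoint. [folklore] -/
theorem uE_conjTranspose : M.uEᴴ = M.uE := swapUnitary_conjTranspose _

/-- `U_E` is an involution. [folklore] -/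
theorem uE_mul_self (h : M.IsLocallyWellFormed) : M.uE * M.uE = 1 :=
  swapUnitary_mul_self (M.thetaE_partialIsometry h) M.thetaE_mul_self

/-- The vector `v ⊗ |d, e⟩` on the erasure register. [folklore] -/
def erVec (v : M.Λ → ℂ) (d e : Bool) : M.Er → ℂ := fun y =>
  if y.2.1 = d ∧ y.2.2 = e then v y.1 else 0

/-- Components of `v ⊗ |d, e⟩` (definitional). [folklore] -/
theorem erVec_apply (v : M.Λ → ℂ) (d e : Bool) (y : M.Er) :
    M.erVec v d e y = if y.2.1 = d ∧ y.2.2 = e then v y.1 else 0 := rfl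

/-- **`U_E` erases the direction of direction-adapted vectors**: for `v ∈ C_d` (i.e. `P_d v = v`),
`U_E (v ⊗ |d, 1⟩) = v ⊗ |L, 0⟩`. [cite: BernsteinVazirani1997SICOMP, Lemma 5.5] -/
theorem uE_mulVec_erVec (h : M.IsLocallyWellFormed) {v : M.Λ → ℂ} {d : Bool}
    (hv : M.dirProj d *ᵥ v = v) : M.uE *ᵥ M.erVec v d true = M.erVec v false false := by
  have e2 : (M.dirProj d *ᵥ v) = fun q' => ∑ q, M.dirProj d q' q * v q := rfl
  unfold uE
  rw [swapUnitary_mulVec M.thetaE_mul_self]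
  · ext x
    have e1 : (M.thetaE *ᵥ M.erVec v d true) x = ∑ y : M.Er, M.thetaE x y * M.erVec v d true y := rfl
    rw [e1, sum_er]
    by_cases hx : x.2.2 = false ∧ x.2.1 = false
    · rw [erVec_apply, if_pos ⟨hx.2, hx.1⟩]
      have h2 := congrFun hv x.1
      rw [e2] at h2
      rw [← h2]
      refine Finset.sum_congr rfl fun q _ => ?_
      simp only [thetaE_apply, erVec_apply, hx, Fintype.sum_bool, and_true, and_self,
        if_true, Bool.false_eq_true, and_false, if_false, mul_zero, add_zero]
      cases d <;> simp
    · rw [erVec_apply, if_neg (fun h' => hx ⟨h'.2, h'.1⟩)]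
      refine Finset.sum_eq_zero fun q _ => Finset.sum_eq_zero fun d' _ =>
        Finset.sum_eq_zero fun e' _ => ?_
      rw [thetaE_apply, if_neg (fun h' => hx h'.2), zero_mul]
  · rw [thetaE_conjTranspose_mul_self M h]
    ext y
    have e1 : (M.gramE *ᵥ M.erVec v d true) y = ∑ y', M.gramE y y' * M.erVec v d true y' := rfl
    rw [e1, sum_er, erVec_apply]
    by_cases hy : y.2.1 = d ∧ y.2.2 = true
    · rw [if_pos hy]
      obtain ⟨hyd, hye⟩ := hy
      have h2 := congrFun hv y.1
      rw [e2] at h2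
      rw [← h2]
      refine Finset.sum_congr rfl fun q _ => ?_
      simp only [gramE, of_apply, erVec_apply, Fintype.sum_bool, hye, true_and, and_true]
      subst hyd
      rcases Bool.eq_false_or_eq_true y.2.1 with hd | hd <;> simp [hd]
    · rw [if_neg hy]
      refine Finset.sum_eq_zero fun q _ => Finset.sum_eq_zero fun d' _ =>
        Finset.sum_eq_zero fun e' _ => ?_
      simp only [gramE, of_apply, erVec_apply]
      by_cases h1 : y.2.2 = true ∧ e' = true ∧ y.2.1 = d'
      · have h3 : ¬ (d' = d ∧ e' = true) := fun h' => hy ⟨h1.2.2.trans h'.1, h1.1⟩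
        rw [if_neg h3, mul_zero]
      · rw [if_neg h1, zero_mul]

end erase


/-! ### The head-centred register, the shift, and the step operator -/

section global

variable (M : QTM) (N : ℕ) [NeZero N]

/-- **The head-centred register** `(q, w, d, e)`: control state, cyclic window `w : ZMod N → Γ` of
tape cells relative to the head (cell `0` scanned), direction bit, marker bit — Nishimura–Ozawa's
wires "cell P" and "cells `-t, …, t`" (proof of Thm. 4.3) in head-relative coordinates, plus the two
work bits. Between steps the reachable states live in `d = L`, `e = 0`. [cite: NishimuraOzawa2002, Thm. 4.3 (proof)] -/
abbrev HC : Type := M.Λ × (ZMod N → M.Γ) × Bool × Bool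

/-- The head-centred register as (local register) × (the window cells other than cell `0`). [folklore] -/
def splitW : M.HC N ≃ M.Loc × ({i : ZMod N // i ≠ 0} → M.Γ) where
  toFun r := ((r.1, r.2.1 0, r.2.2.1, r.2.2.2), fun i => r.2.1 i)
  invFun p := (p.1.1, fun i => if h : i = 0 then p.1.2.1 else p.2 ⟨i, h⟩, p.1.2.2.1, p.1.2.2.2)
  left_inv := by
    rintro ⟨q, w, d, e⟩
    simp only [Prod.mk.injEq, true_and, and_true]
    funext i
    by_cases h : i = 0
    · subst h
      simp
    · simp [h]
  right_inv := by
    rintro ⟨⟨q, σ, d, e⟩, w'⟩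
    refine Prod.ext ?_ ?_
    · simp
    · funext i
      simp [i.2]

omit [NeZero N] in
/-- The local component of a head-centred basis state: `(q, w 0, d, e)`. [folklore] -/
@[simp] theorem splitW_apply_fst (r : M.HC N) :
    (M.splitW N r).1 = (r.1, r.2.1 0, r.2.2.1, r.2.2.2) := rfl

omit [NeZero N] in
/-- The non-local component of a head-centred basis state: the window off cell `0`. [folklore] -/
@[simp] theorem splitW_apply_snd (r : M.HC N) :
    (M.splitW N r).2 = fun i : {i : ZMod N // i ≠ 0} => r.2.1 i := rfl

/-- The head-centred register as (erasure register) × (window). [folklore] -/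
def splitE : M.HC N ≃ M.Er × (ZMod N → M.Γ) where
  toFun r := ((r.1, r.2.2.1, r.2.2.2), r.2.1)
  invFun p := (p.1.1, p.2, p.1.2.1, p.1.2.2)
  left_inv _ := rfl
  right_inv _ := rfl

omit [NeZero N] in
/-- The erasure component of a head-centred basis state: `(q, d, e)`. [folklore] -/
@[simp] theorem splitE_apply_fst (r : M.HC N) : (M.splitE N r).1 = (r.1, r.2.2.1, r.2.2.2) := rfl

omit [NeZero N] in
/-- The window component of a head-centred basis state. [folklore] -/
@[simp] theorem splitE_apply_snd (r : M.HC N) : (M.splitE N r).2 = r.2.1 := rfl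

/-- The window shift of a head move as an element of `ZMod N`: `+1` for a right move, `-1` for a left move. [folklore] -/
def bshift (d : Bool) : ZMod N := if d then 1 else -1

/-- **The controlled cyclic shift** of the window by the direction bit: `(q, w, d, e) ↦ (q, i ↦ w (i ± 1), d, e)`
— the head-relative form of the head move (Nishimura–Ozawa's gate `G₂` re-centres nothing because
their cells are absolute; here the whole window moves instead of the head). A permutation of the
basis. [cite: NishimuraOzawa2002, Thm. 4.3 (proof, gate G₂)] -/
def shiftEquiv : Equiv.Perm (M.HC N) where
  toFun r := (r.1, fun i => r.2.1 (i + bshift N r.2.2.1), r.2.2.1, r.2.2.2)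
  invFun r := (r.1, fun i => r.2.1 (i - bshift N r.2.2.1), r.2.2.1, r.2.2.2)
  left_inv := by
    rintro ⟨q, w, d, e⟩
    simp
  right_inv := by
    rintro ⟨q, w, d, e⟩
    simp

omit [NeZero N] in
/-- The controlled shift on basis states (definitional). [folklore] -/
theorem shiftEquiv_apply (r : M.HC N) :
    M.shiftEquiv N r = (r.1, fun i => r.2.1 (i + bshift N r.2.2.1), r.2.2.1, r.2.2.2) := rfl

omit [NeZero N] in
/-- The inverse controlled shift on basis states (definitional). [folklore] -/
theorem shiftEquiv_symm_apply (r : M.HC N) :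
    (M.shiftEquiv N).symm r = (r.1, fun i => r.2.1 (i - bshift N r.2.2.1), r.2.2.1, r.2.2.2) := rfl

/-- **The shift unitary `U_S`**: the permutation matrix of the controlled cyclic shift. [folklore] -/
def uS : Matrix (M.HC N) (M.HC N) ℂ := Matrix.of fun a b => if M.shiftEquiv N b = a then 1 else 0

/-- Entries of `U_S` (definitional). [folklore] -/
theorem uS_apply (a b : M.HC N) : M.uS N a b = if M.shiftEquiv N b = a then 1 else 0 := rfl

/-- `U_S` permutes amplitudes: `(U_S x)(a) = x(shift⁻¹ a)`. [folklore] -/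
theorem uS_mulVec (x : M.HC N → ℂ) : M.uS N *ᵥ x = fun a => x ((M.shiftEquiv N).symm a) := by
  ext a
  have e1 : (M.uS N *ᵥ x) a = ∑ b, M.uS N a b * x b := rfl
  rw [e1, Finset.sum_eq_single ((M.shiftEquiv N).symm a)]
  · simp [uS_apply]
  · intro b _ hb
    rw [uS_apply, if_neg, zero_mul]
    intro h'
    apply hb
    rw [← h', Equiv.symm_apply_apply]
  · intro h'
    exact absurd (Finset.mem_univ _) h'

/-- `U_S U_Sᴴ = 1`. [folklore] -/
theorem uS_mul_conjTranspose : M.uS N * (M.uS N)ᴴ = 1 := by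
  ext a c
  rw [mul_apply, Finset.sum_eq_single ((M.shiftEquiv N).symm a)]
  · simp only [conjTranspose_apply, uS_apply, Equiv.apply_symm_apply, if_true, one_mul, one_apply]
    by_cases hac : a = c
    · subst hac
      simp
    · rw [if_neg hac, star_zero]
  · intro b _ hb
    rw [uS_apply, if_neg, zero_mul]
    intro h'
    apply hb
    rw [← h', Equiv.symm_apply_apply]
  · intro h'
    exact absurd (Finset.mem_univ _) h'

/-- `U_S` is unitary. [folklore] -/
theorem uS_mem_unitaryGroup : M.uS N ∈ Matrix.unitaryGroup (M.HC N) ℂ := by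
  rw [Matrix.mem_unitaryGroup_iff, star_eq_conjTranspose, uS_mul_conjTranspose]

/-- `U_W` placed on the components (state, cell `0`, `d`, `e`) of the head-centred register. [cite: NishimuraOzawa2002, Thm. 4.3 (proof)] -/
def uWG : Matrix (M.HC N) (M.HC N) ℂ := liftMat (M.splitW N) M.uW

/-- `U_E` placed on the components (state, `d`, `e`) of the head-centred register. [cite: BernsteinVazirani1997SICOMP, Lemma 5.5] -/
def uEG : Matrix (M.HC N) (M.HC N) ℂ := liftMat (M.splitE N) M.uE

/-- **The head-centred step operator** `U = U_E · U_S · U_W` on the head-centred register: local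
transition, controlled window shift, direction erasure — one step of `M` in the tree's head-relative
semantics (`enc_evolve`), the analogue of Nishimura–Ozawa's `K₂ ∘ K₁` (proof of Thm. 4.3) with ONE
local gate instead of `2t - 1` because the head is pinned at cell `0`. [cite: NishimuraOzawa2002, Thm. 4.3 (proof)] -/
def hcStep : Matrix (M.HC N) (M.HC N) ℂ := M.uEG N * M.uS N * M.uWG N

/-- **The step operator is unitary** for every machine satisfying Bernstein–Vazirani's three local
conditions — hence (`QTM.IsWellFormed.isLocallyWellFormed`) for every well-formed machine over a tape
alphabet with at least two symbols. [cite: NishimuraOzawa2002, Thm. 4.3] -/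
theorem hcStep_mem_unitaryGroup (h : M.IsLocallyWellFormed) :
    M.hcStep N ∈ Matrix.unitaryGroup (M.HC N) ℂ :=
  Submonoid.mul_mem _ (Submonoid.mul_mem _ (liftMat_mem_unitaryGroup _ (M.uE_mem_unitaryGroup h))
    (M.uS_mem_unitaryGroup N)) (liftMat_mem_unitaryGroup _ (M.uW_mem_unitaryGroup h))

/-! ### Encoding configurations and the one-step simulation identity -/

/-- The basis state of the head-centred register encoding a (head-relative) configuration:
`(q, window of the tape, L, 0)` — Nishimura–Ozawa's encoding `|q₀, tape[x], 0⟩ ↦ |q; T(-t)0̄; …; T(0)1̄; …⟩`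
in head-relative coordinates. [cite: NishimuraOzawa2002, §4 (t-simulation) and Thm. 4.3 (proof)] -/
def encCfg (c : M.Cfg) : M.HC N := (c.q, window N c.tape, false, false)

/-- The amplitude vector on the head-centred register of a finitely supported superposition of
configurations (push-forward along `encCfg`; amplitudes of configurations with the same code are added,
which does not happen within the radius bounds below, `encCfg_injOn`). [folklore] -/
def enc (ψ : M.Cfg →₀ ℂ) : M.HC N → ℂ := ⇑(Finsupp.mapDomain (M.encCfg N) ψ)

/-- The code of a basis state is a basis vector. [folklore] -/
theorem enc_single (c : M.Cfg) (a : ℂ) :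
    M.enc N (Finsupp.single c a) = a • (Pi.single (M.encCfg N c) (1 : ℂ) : M.HC N → ℂ) := by
  unfold enc
  rw [Finsupp.mapDomain_single, Finsupp.single_eq_pi_single]
  ext y
  simp [Pi.single_apply]

omit [NeZero N] in
/-- Encoding is additive. [folklore] -/
theorem enc_finset_sum {ι : Type*} (s : Finset ι) (f : ι → M.Cfg →₀ ℂ) :
    M.enc N (∑ i ∈ s, f i) = ∑ i ∈ s, M.enc N (f i) := by
  unfold enc
  rw [Finsupp.mapDomain_finsetSum, Finsupp.coe_finsetSum]

omit [NeZero N] in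
/-- A window equals `w` updated at cell `0` iff it has the new symbol at `0` and agrees with `w` off `0`. [folklore] -/
theorem eq_update_zero_iff (f g : ZMod N → M.Γ) (τ : M.Γ) :
    f = Function.update g 0 τ ↔
      τ = f 0 ∧ (fun i : {i : ZMod N // i ≠ 0} => f i) = fun i : {i : ZMod N // i ≠ 0} => g i := by
  rw [Function.eq_update_iff]
  constructor
  · rintro ⟨h1, h2⟩
    exact ⟨h1.symm, funext fun i => h2 i i.2⟩
  · rintro ⟨h1, h2⟩
    exact ⟨h1.symm, fun i hi => congrFun h2 ⟨i, hi⟩⟩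

/-- **Stage 1** (local transition): on the code of a configuration `c = (q, T)`,
`U_W |enc c⟩ = ∑_{τ, d} (δ(q, T₀ | τ, d) ⊗ |d, 1⟩) ⊗ |window(T) with cell 0 := τ⟩` — the restricted
superpositions appear, tagged with their direction, the written symbol in cell `0`
(Nishimura–Ozawa, proof of Thm. 4.3, the displayed action of the `i`-th `G₁`). [cite: NishimuraOzawa2002, Thm. 4.3 (proof)] -/
theorem uWG_mulVec_single (h : M.IsLocallyWellFormed) (c : M.Cfg) :
    M.uWG N *ᵥ Pi.single (M.encCfg N c) 1 =
      ∑ τ : M.Γ, ∑ d : Bool, prodVec (M.splitE N) (M.erVec (M.resVec c.q c.tape.head τ d) d true)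
        (Pi.single (Function.update (window N c.tape) 0 τ) 1) := by
  unfold uWG
  rw [pi_single_eq_prodVec (M.splitW N), liftMat_mulVec_prodVec, splitW_apply_fst]
  simp only [encCfg, window_zero]
  rw [uW_mulVec_single M h]
  ext y
  obtain ⟨q', w, d', e'⟩ := y
  simp only [prodVec_apply, splitW_apply_fst, splitW_apply_snd, splitE_apply_fst, splitE_apply_snd,
    Finset.sum_apply, erVec_apply, resVec, Pi.single_apply]
  simp only [ite_and]
  cases e'
  · simp
  · simp only [if_true]
    symm
    calc ∑ x : M.Γ, ∑ x_1 : Bool, ((if d' = x_1 then M.δ c.q c.tape.head q' x (dirOfBool x_1) else 0) *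
            (if w = Function.update (window N c.tape) 0 x then 1 else 0))
        = ∑ x : M.Γ, (if w = Function.update (window N c.tape) 0 x then
            M.δ c.q c.tape.head q' x (dirOfBool d') else 0) := by
          refine Finset.sum_congr rfl fun x _ => ?_
          rw [← Finset.sum_mul, Finset.sum_ite_eq, if_pos (Finset.mem_univ _)]
          split_ifs <;> simp
      _ = _ := by
          simp only [eq_update_zero_iff, ite_and, Finset.sum_ite_eq', Finset.mem_univ, if_true,
            mul_ite, mul_one, mul_zero]

/-- **Stage 2** (shift): `U_S` shifts the window of a direction-tagged product vector by its direction. [folklore] -/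
theorem uS_mulVec_prodVec_erVec (v : M.Λ → ℂ) (d e : Bool) (w₁ : ZMod N → M.Γ) :
    M.uS N *ᵥ prodVec (M.splitE N) (M.erVec v d e) (Pi.single w₁ 1) =
      prodVec (M.splitE N) (M.erVec v d e) (Pi.single (fun i => w₁ (i + bshift N d)) 1) := by
  rw [uS_mulVec]
  ext a
  obtain ⟨q, w, d₀, e₀⟩ := a
  simp only [prodVec_apply, shiftEquiv_symm_apply, splitE_apply_fst, splitE_apply_snd, erVec_apply,
    Pi.single_apply]
  by_cases hd : d₀ = d ∧ e₀ = e
  · obtain ⟨rfl, rfl⟩ := hd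
    have hPQ : ((fun i => w (i - bshift N d₀)) = w₁) ↔ (w = fun i => w₁ (i + bshift N d₀)) := by
      constructor
      · intro h'
        rw [← h']
        funext i
        simp
      · intro h'
        rw [h']
        funext i
        simp
    simp only [and_self, if_true, hPQ]
  · rw [if_neg hd, zero_mul, zero_mul]

/-- Writing then moving, seen through the window: updating cell `0` and shifting cyclically by the
direction IS the window of the successor tape (within radius, `2r + 1 ≤ N`). [folklore] -/
theorem update_window_shift {r : ℕ} {T : Tape M.Γ} (hT : BlankBeyond r T) (hr : 1 ≤ r)
    (hN : 2 * r + 1 ≤ N) (τ : M.Γ) (d : Bool) :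
    (fun i => Function.update (window N T) 0 τ (i + bshift N d)) =
      window N ((T.write τ).move (dirOfBool d)) := by
  rw [← window_write, window_move (hT.write hr τ) hN d]
  rfl

/-- **Stage 3** (erasure): `U_E` resets the direction tag and the marker of a tagged restricted
superposition, `(δ(q,σ|τ,d) ⊗ |d,1⟩) ⊗ |w'⟩ ↦ (δ(q,σ|τ,d) ⊗ |L,0⟩) ⊗ |w'⟩`, because `δ(q,σ|τ,d) ∈ C_d`.
[cite: BernsteinVazirani1997SICOMP, Lemma 5.5] -/
theorem uEG_mulVec_prodVec (h : M.IsLocallyWellFormed) (q : M.Λ) (σ τ : M.Γ) (d : Bool)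
    (w' : ZMod N → M.Γ) :
    M.uEG N *ᵥ prodVec (M.splitE N) (M.erVec (M.resVec q σ τ d) d true) (Pi.single w' 1) =
      prodVec (M.splitE N) (M.erVec (M.resVec q σ τ d) false false) (Pi.single w' 1) := by
  unfold uEG
  rw [liftMat_mulVec_prodVec, uE_mulVec_erVec M h (M.dirProj_mulVec_resVec q σ τ d)]

/-- A rested product vector `(v ⊗ |L,0⟩) ⊗ |w'⟩` as a combination of codes `∑_{q'} v(q') |(q', w', L, 0)⟩`. [folklore] -/
theorem prodVec_erVec_rest (v : M.Λ → ℂ) (w' : ZMod N → M.Γ) :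
    prodVec (M.splitE N) (M.erVec v false false) (Pi.single w' 1) =
      ∑ q' : M.Λ, v q' • (Pi.single ((q', w', false, false) : M.HC N) (1 : ℂ) : M.HC N → ℂ) := by
  ext y
  obtain ⟨yq, yw, yd, ye⟩ := y
  simp only [prodVec_apply, splitE_apply_fst, splitE_apply_snd, erVec_apply, Finset.sum_apply,
    Pi.smul_apply, Pi.single_apply, Prod.mk.injEq, smul_eq_mul, mul_ite, mul_one, mul_zero]
  simp only [ite_and]
  rw [Finset.sum_ite_eq Finset.univ yq, if_pos (Finset.mem_univ _)]

/-- **One step on a basis state**: for a configuration of radius `r ≥ 1` and a window of size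
`N ≥ 2r + 3`, `enc (U_M |c⟩) = U · enc |c⟩` — the head-centred step operator reproduces the tree's
`QTM.evolve`, INCLUDING the addition of the amplitudes of the two update triples `(q', τ, L)`, `(q', τ, R)`
when they lead to the same head-relative configuration (both land on the same code after erasure).
(Nishimura–Ozawa, proof of Thm. 4.3: "it can be verified that `K₂ ∘ K₁` simulates the operation of `M`
such that …".) [cite: NishimuraOzawa2002, Thm. 4.3 (proof)] -/
theorem enc_evolve_single (h : M.IsLocallyWellFormed) {r : ℕ} (hr : 1 ≤ r) (hN : 2 * r + 3 ≤ N)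
    (c : M.Cfg) (hc : BlankBeyond r c.tape) (a : ℂ) :
    M.enc N (M.evolve (Finsupp.single c a)) = M.hcStep N *ᵥ M.enc N (Finsupp.single c a) := by
  have hN' : 2 * r + 1 ≤ N := by omega
  -- the right-hand side
  rw [enc_single, mulVec_smul, hcStep, ← mulVec_mulVec, ← mulVec_mulVec, uWG_mulVec_single M N h,
    mulVec_sum, mulVec_sum]
  simp only [mulVec_sum, uS_mulVec_prodVec_erVec, M.update_window_shift N hc hr hN',
    uEG_mulVec_prodVec M N h, prodVec_erVec_rest, resVec]
  -- the left-hand side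
  rw [evolve_single_eq_sum, enc_finset_sum]
  simp only [Finsupp.smul_single, smul_eq_mul, mul_one, enc_single]
  simp only [Fintype.sum_prod_type, Finset.smul_sum, smul_smul, updAmp, updTarget, encCfg]
  exact (Finset.sum_congr rfl fun d _ => Finset.sum_comm).trans Finset.sum_comm

/-- **One step**: `enc (U_M ψ) = U · enc ψ` for superpositions supported on configurations of radius
`r ≥ 1`, window size `N ≥ 2r + 3`. [cite: NishimuraOzawa2002, Thm. 4.3 (proof)] -/
theorem enc_evolve (h : M.IsLocallyWellFormed) {r : ℕ} (hr : 1 ≤ r) (hN : 2 * r + 3 ≤ N)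
    (ψ : M.Cfg →₀ ℂ) (hψ : ∀ c ∈ ψ.support, BlankBeyond r c.tape) :
    M.enc N (M.evolve ψ) = M.hcStep N *ᵥ M.enc N ψ := by
  have hψeq : (∑ c ∈ ψ.support, Finsupp.single c (ψ c)) = ψ := Finsupp.sum_single ψ
  rw [evolve_eq_finsuppSum]
  unfold Finsupp.sum
  rw [enc_finset_sum]
  conv_rhs => rw [← hψeq]
  rw [enc_finset_sum, mulVec_sum]
  exact Finset.sum_congr rfl fun c hcψ => M.enc_evolve_single N h hr hN c (hψ c hcψ) (ψ c)

/-- One step increases the radius of the support by at most one. [folklore] -/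
theorem blankBeyond_support_evolve {r : ℕ} (hr : 1 ≤ r) (ψ : M.Cfg →₀ ℂ)
    (hψ : ∀ c ∈ ψ.support, BlankBeyond r c.tape) :
    ∀ c ∈ (M.evolve ψ).support, BlankBeyond (r + 1) c.tape := by
  classical
  intro c hc
  rw [evolve_eq_sum] at hc
  obtain ⟨i, -, rfl⟩ := Finset.mem_image.1 (support_finsuppSum_subset _ _ hc)
  exact ((hψ i.1 i.1.2).write hr _).move _

/-- After `t` steps on input `x` every configuration in the support has radius `|x| + 1 + t`
(the machine cannot be outside cells `-t, …, |x| + t`; Nishimura–Ozawa, §4). [cite: NishimuraOzawa2002, §4] -/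
theorem blankBeyond_support_stateAt (x : List Bool) (t : ℕ) :
    ∀ c ∈ (M.stateAt x t).support, BlankBeyond (x.length + 1 + t) c.tape := by
  induction t with
  | zero =>
    intro c hc
    have hc' : c = M.init x := by
      simpa using Finsupp.support_single_subset hc
    subst hc'
    have := blankBeyond_mk₁ (x.map M.embed)
    rw [List.length_map] at this
    exact this.mono (by omega)
  | succ t ih =>
    intro c hc
    unfold stateAt at hc ih
    rw [Function.iterate_succ_apply'] at hc
    exact M.blankBeyond_support_evolve (r := x.length + 1 + t) (by omega) _ ih c hc

/-- **`t` steps**: `enc (U_M^t |init x⟩) = U^t |enc (init x)⟩` whenever `N ≥ 2(|x| + t) + 3` — the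
head-centred analogue of "`K_G = (K₂ ∘ K₁)^t` `t`-simulates `M`" (Nishimura–Ozawa 2002, Thm. 4.3), exact
(accuracy `ε = 0`). [cite: NishimuraOzawa2002, Thm. 4.3] -/
theorem enc_stateAt (h : M.IsLocallyWellFormed) (x : List Bool) (t : ℕ)
    (hN : 2 * (x.length + t) + 3 ≤ N) :
    M.enc N (M.stateAt x t) = (M.hcStep N) ^ t *ᵥ Pi.single (M.encCfg N (M.init x)) 1 := by
  induction t with
  | zero =>
    simp only [stateAt, Function.iterate_zero, id_eq, pow_zero, one_mulVec]
    rw [enc_single, one_smul]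
  | succ t ih =>
    have ih' := ih (by omega)
    unfold stateAt at ih' ⊢
    rw [Function.iterate_succ_apply', pow_succ', ← mulVec_mulVec, ← ih']
    exact M.enc_evolve N h (r := x.length + 1 + t) (by omega) (by omega) _
      (M.blankBeyond_support_stateAt x t)

/-- Within radius `r`, `2r + 1 ≤ N`, distinct configurations have distinct codes. [folklore] -/
theorem encCfg_injOn {r : ℕ} (hN : 2 * r + 1 ≤ N) (S : Set M.Cfg) (hS : ∀ c ∈ S, BlankBeyond r c.tape) :
    Set.InjOn (M.encCfg N) S := by
  intro c₁ h₁ c₂ h₂ he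
  simp only [encCfg, Prod.mk.injEq, and_true] at he
  obtain ⟨q₁, T₁⟩ := c₁
  obtain ⟨q₂, T₂⟩ := c₂
  simp only at he
  obtain ⟨rfl, hw⟩ := he
  have hT : T₁ = T₂ := eq_of_window_eq (hS _ h₁) (hS _ h₂) hN hw
  rw [hT]

/-- Observables diagonal in the control state have the same expectation on `ψ` and on its code, as soon
as the encoding is injective on the support. [folklore] -/
theorem sum_enc_eq_of_injOn (ψ : M.Cfg →₀ ℂ) (hinj : Set.InjOn (M.encCfg N) ψ.support)
    (G : M.Λ → ℂ → ℝ) (hG : ∀ q, G q 0 = 0) :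
    ∑ y : M.HC N, G y.1 (M.enc N ψ y) = ψ.sum fun c a => G c.q a := by
  classical
  unfold enc
  rw [← Finsupp.sum_fintype (Finsupp.mapDomain (M.encCfg N) ψ) (fun y a => G y.1 a) fun y => hG y.1]
  unfold Finsupp.sum
  rw [Finsupp.mapDomain_support_of_injOn ψ hinj, Finset.sum_image hinj]
  refine Finset.sum_congr rfl fun c hc => ?_
  rw [Finsupp.mapDomain_apply' (ψ.support : Set M.Cfg) ψ subset_rfl hinj (Finset.mem_coe.2 hc)]
  rfl

/-- Observables diagonal in the control state have the same expectation on `ψ` and on its code (radius form). [folklore] -/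
theorem sum_enc_eq {r : ℕ} (hN : 2 * r + 1 ≤ N) (ψ : M.Cfg →₀ ℂ)
    (hψ : ∀ c ∈ ψ.support, BlankBeyond r c.tape) (G : M.Λ → ℂ → ℝ) (hG : ∀ q, G q 0 = 0) :
    ∑ y : M.HC N, G y.1 (M.enc N ψ y) = ψ.sum fun c a => G c.q a :=
  M.sum_enc_eq_of_injOn N ψ (M.encCfg_injOn N hN _ fun c hc => hψ c hc) G hG

/-- **The tree's acceptance probability is a Born probability of the simulating register.** For a
machine satisfying Bernstein–Vazirani's local conditions, `QTM.acceptProbAt M x t` — the probability of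
observing the accepting control state at time `t` in the tree's head-relative semantics — equals the
probability of the event "state component `= accept`" in the unit vector `U^t |enc (init x)⟩` of the
finite register `HC M N`, `N ≥ 2(|x| + t) + 3`, `U` unitary (`hcStep_mem_unitaryGroup`). This is the
`ε = 0` case of `t`-simulation (Nishimura–Ozawa 2002, §4 and Thm. 4.3) for the tree's model, the
measured observable being the control state rather than the tape. [cite: NishimuraOzawa2002, Thm. 4.3] -/
theorem acceptProbAt_eq_hcStep (h : M.IsLocallyWellFormed) (x : List Bool) (t : ℕ)
    (hN : 2 * (x.length + t) + 3 ≤ N) :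
    M.acceptProbAt x t = ∑ y : M.HC N,
      if y.1 = M.accept then ‖((M.hcStep N) ^ t *ᵥ Pi.single (M.encCfg N (M.init x)) 1) y‖ ^ 2
      else 0 := by
  rw [← M.enc_stateAt N h x t hN, acceptProbAt]
  symm
  exact M.sum_enc_eq N (r := x.length + 1 + t) (by omega) _ (M.blankBeyond_support_stateAt x t)
    (fun q a => if q = M.accept then ‖a‖ ^ 2 else 0) fun q => by simp

end global


/-! ### One-symbol alphabets: the state-marginal unitary -/

section subsingleton

variable (M : QTM)

/-- Over a one-symbol tape alphabet all Mathlib tapes coincide (cf. `QTM.tape_unit_subsingleton`): the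
head-relative configuration space is the state set. [folklore] -/
theorem tape_subsingleton [Subsingleton M.Γ] : Subsingleton (Tape M.Γ) :=
  ⟨fun T₁ T₂ => by
    obtain ⟨a, L, R⟩ := T₁
    obtain ⟨a', L', R'⟩ := T₂
    congr 1
    · exact Subsingleton.elim _ _
    · exact ListBlank.ext fun _ => Subsingleton.elim _ _
    · exact ListBlank.ext fun _ => Subsingleton.elim _ _⟩

/-- Over a one-symbol alphabet configurations are equal iff their control states are. [folklore] -/
theorem cfg_eq_iff [Subsingleton M.Γ] (c₁ c₂ : M.Cfg) : c₁ = c₂ ↔ c₁.q = c₂.q := by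
  obtain ⟨q₁, T₁⟩ := c₁
  obtain ⟨q₂, T₂⟩ := c₂
  have hT : T₁ = T₂ := (M.tape_subsingleton).elim _ _
  subst hT
  simp

/-- The state-marginal step matrix `A(q', q) = ∑_{τ, d} δ(q, ␣, q', τ, d)` of a machine over a one-symbol
alphabet: both directions lead to the same head-relative configuration, so their amplitudes ADD
(the tree's translation-quotient semantics; `ModelExamples.halfHalf`, `hadamardWalk` in
`QuantumTuringMachineLocalConditions.lean`). [folklore] -/
def localSum : Matrix M.Λ M.Λ ℂ := Matrix.of fun q' q =>
  ∑ b : M.Γ, (M.δ q default q' b Dir.left + M.δ q default q' b Dir.right)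

/-- Entries of the state-marginal step matrix (definitional). [folklore] -/
theorem localSum_apply (q' q : M.Λ) :
    M.localSum q' q = ∑ b : M.Γ, (M.δ q default q' b Dir.left + M.δ q default q' b Dir.right) := rfl

/-- Summing the amplitudes of the update triples with new state `q'` gives `A(q', q)`. [folklore] -/
theorem sum_upd_ite_eq_localSum [Subsingleton M.Γ] (c : M.Cfg) (q' : M.Λ) (z : ℂ) :
    ∑ u : M.Upd, (if u.2.1 = q' then z * M.updAmp c u else 0) = z * M.localSum q' c.q := by
  have hh : c.tape.head = default := Subsingleton.elim _ _
  simp only [Upd, Fintype.sum_prod_type, Fintype.sum_bool, updAmp, dirOfBool_true, dirOfBool_false,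
    hh, localSum_apply]
  have key : ∀ f : M.Λ → M.Γ → ℂ,
      (∑ x : M.Λ, ∑ b : M.Γ, if x = q' then f x b else 0) = ∑ b, f q' b := by
    intro f
    rw [Finset.sum_comm]
    simp only [Finset.sum_ite_eq', Finset.mem_univ, if_true]
  rw [key, key, ← Finset.sum_add_distrib, Finset.mul_sum]
  exact Finset.sum_congr rfl fun b _ => by ring

/-- Over a one-symbol alphabet the Gram coefficients of the time evolution (`QTM.gram`, proof of BV
Thm. 5.3) are the entries of `Aᴴ A`. [cite: BernsteinVazirani1997SICOMP, Thm. 5.3 (proof)] -/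
theorem gram_eq_of_subsingleton [Subsingleton M.Γ] (c₁ c₂ : M.Cfg) :
    M.gram c₁ c₂ = (M.localSumᴴ * M.localSum) c₂.q c₁.q := by
  classical
  rw [gram, mul_apply]
  simp only [conjTranspose_apply, RCLike.star_def]
  have htgt : ∀ u₁ u₂ : M.Upd, (M.updTarget c₁ u₁ = M.updTarget c₂ u₂) = (u₁.2.1 = u₂.2.1) := by
    intro u₁ u₂
    rw [cfg_eq_iff]
    rfl
  simp only [htgt]
  calc ∑ u₁ : M.Upd, ∑ u₂ : M.Upd,
        (if u₁.2.1 = u₂.2.1 then M.updAmp c₁ u₁ * conj (M.updAmp c₂ u₂) else 0)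
      = ∑ u₁ : M.Upd, M.updAmp c₁ u₁ * conj (M.localSum u₁.2.1 c₂.q) := by
        refine Finset.sum_congr rfl fun u₁ _ => ?_
        have h2 := M.sum_upd_ite_eq_localSum c₂ u₁.2.1 1
        rw [one_mul] at h2
        rw [← h2, map_sum, Finset.mul_sum]
        refine Finset.sum_congr rfl fun u₂ _ => ?_
        by_cases h12 : u₁.2.1 = u₂.2.1
        · rw [if_pos h12, if_pos h12.symm, one_mul]
        · rw [if_neg h12, if_neg (Ne.symm h12), map_zero, mul_zero]
    _ = ∑ u₁ : M.Upd, ∑ q' : M.Λ,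
          (if u₁.2.1 = q' then conj (M.localSum q' c₂.q) * M.updAmp c₁ u₁ else 0) := by
        refine Finset.sum_congr rfl fun u₁ _ => ?_
        rw [Finset.sum_ite_eq Finset.univ u₁.2.1, if_pos (Finset.mem_univ _), mul_comm]
    _ = ∑ q' : M.Λ, conj (M.localSum q' c₂.q) * M.localSum q' c₁.q := by
        rw [Finset.sum_comm]
        refine Finset.sum_congr rfl fun q' _ => ?_
        exact M.sum_upd_ite_eq_localSum c₁ q' _

/-- **Over a one-symbol alphabet, tree well-formedness is unitarity of `A = δ_L + δ_R`** (and NOT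
Bernstein–Vazirani's local conditions, which may fail: `ModelExamples.halfHalf`), by the Gram form of
well-formedness `QTM.isWellFormed_iff_gram`. [cite: BernsteinVazirani1997SICOMP, Thm. 5.3 (proof)] -/
theorem localSum_mem_unitaryGroup [Subsingleton M.Γ] (hwf : M.IsWellFormed) :
    M.localSum ∈ Matrix.unitaryGroup M.Λ ℂ := by
  classical
  rw [Matrix.mem_unitaryGroup_iff', star_eq_conjTranspose]
  rw [isWellFormed_iff_gram] at hwf
  ext q₂ q₁
  have h := hwf ⟨q₁, default⟩ ⟨q₂, default⟩
  rw [gram_eq_of_subsingleton] at h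
  rw [h, one_apply, cfg_eq_iff]
  simp only [eq_comm]

variable (N : ℕ) [NeZero N]

/-- The step operator for one-symbol alphabets: `A` on the state component of the head-centred register. [folklore] -/
def hcStep₁ : Matrix (M.HC N) (M.HC N) ℂ :=
  liftMat (Equiv.refl (M.HC N)) M.localSum

/-- The one-symbol step operator is unitary for tree-well-formed machines. [folklore] -/
theorem hcStep₁_mem_unitaryGroup [Subsingleton M.Γ] (hwf : M.IsWellFormed) :
    M.hcStep₁ N ∈ Matrix.unitaryGroup (M.HC N) ℂ :=
  liftMat_mem_unitaryGroup _ (M.localSum_mem_unitaryGroup hwf)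

/-- One step on a basis state, one-symbol alphabet: `enc (U_M |c⟩) = (A ⊗ 1) enc |c⟩` (no radius condition). [folklore] -/
theorem enc_evolve_single₁ [Subsingleton M.Γ] (c : M.Cfg) (a : ℂ) :
    M.enc N (M.evolve (Finsupp.single c a)) = M.hcStep₁ N *ᵥ M.enc N (Finsupp.single c a) := by
  classical
  have hw : ∀ T : Tape M.Γ, window N T = window N c.tape := fun T => Subsingleton.elim _ _
  -- right-hand side
  rw [enc_single, mulVec_smul, hcStep₁, pi_single_eq_prodVec (Equiv.refl (M.HC N)),
    liftMat_mulVec_prodVec, mulVec_single_one, prodVec_single_right]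
  simp only [Equiv.refl_symm, Equiv.refl_apply, col_apply, encCfg, Finset.smul_sum, smul_smul]
  -- left-hand side
  rw [evolve_single_eq_sum, enc_finset_sum]
  simp only [Finsupp.smul_single, smul_eq_mul, mul_one, enc_single, encCfg, updTarget, hw]
  symm
  calc ∑ q' : M.Λ, (a * M.localSum q' c.q) •
          (Pi.single ((q', window N c.tape, false, false) : M.HC N) (1 : ℂ) : M.HC N → ℂ)
      = ∑ q' : M.Λ, ∑ u : M.Upd, (if u.2.1 = q' then a * M.updAmp c u else 0) •
          (Pi.single ((q', window N c.tape, false, false) : M.HC N) (1 : ℂ) : M.HC N → ℂ) := by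
        refine Finset.sum_congr rfl fun q' _ => ?_
        rw [← Finset.sum_smul, sum_upd_ite_eq_localSum]
    _ = ∑ u : M.Upd, (a * M.updAmp c u) •
          (Pi.single ((u.2.1, window N c.tape, false, false) : M.HC N) (1 : ℂ) : M.HC N → ℂ) := by
        rw [Finset.sum_comm]
        refine Finset.sum_congr rfl fun u _ => ?_
        simp only [ite_smul, zero_smul]
        rw [Finset.sum_ite_eq Finset.univ u.2.1, if_pos (Finset.mem_univ _)]

/-- One step, one-symbol alphabet: `enc (U_M ψ) = (A ⊗ 1) enc ψ`. [folklore] -/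
theorem enc_evolve₁ [Subsingleton M.Γ] (ψ : M.Cfg →₀ ℂ) :
    M.enc N (M.evolve ψ) = M.hcStep₁ N *ᵥ M.enc N ψ := by
  have hψeq : (∑ c ∈ ψ.support, Finsupp.single c (ψ c)) = ψ := Finsupp.sum_single ψ
  rw [evolve_eq_finsuppSum]
  unfold Finsupp.sum
  rw [enc_finset_sum]
  conv_rhs => rw [← hψeq]
  rw [enc_finset_sum, mulVec_sum]
  exact Finset.sum_congr rfl fun c _ => M.enc_evolve_single₁ N c (ψ c)

/-- `t` steps, one-symbol alphabet: `enc (U_M^t |init x⟩) = (A ⊗ 1)^t |enc (init x)⟩`. [folklore] -/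
theorem enc_stateAt₁ [Subsingleton M.Γ] (x : List Bool) (t : ℕ) :
    M.enc N (M.stateAt x t) = (M.hcStep₁ N) ^ t *ᵥ Pi.single (M.encCfg N (M.init x)) 1 := by
  induction t with
  | zero =>
    simp only [stateAt, Function.iterate_zero, id_eq, pow_zero, one_mulVec]
    rw [enc_single, one_smul]
  | succ t ih =>
    unfold stateAt at ih ⊢
    rw [Function.iterate_succ_apply', pow_succ', ← mulVec_mulVec, ← ih]
    exact M.enc_evolve₁ N _

omit [NeZero N] in
/-- Over a one-symbol alphabet the encoding is injective outright. [folklore] -/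
theorem encCfg_injective₁ [Subsingleton M.Γ] : Function.Injective (M.encCfg N) := by
  intro c₁ c₂ he
  rw [cfg_eq_iff]
  simp only [encCfg, Prod.mk.injEq] at he
  exact he.1

/-- The tree's acceptance probability as a Born probability of the simulating register, one-symbol
alphabet (no condition on `N`). [folklore] -/
theorem acceptProbAt_eq_hcStep₁ [Subsingleton M.Γ] (x : List Bool) (t : ℕ) :
    M.acceptProbAt x t = ∑ y : M.HC N,
      if y.1 = M.accept then ‖((M.hcStep₁ N) ^ t *ᵥ Pi.single (M.encCfg N (M.init x)) 1) y‖ ^ 2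
      else 0 := by
  rw [← M.enc_stateAt₁ N x t, acceptProbAt]
  symm
  exact M.sum_enc_eq_of_injOn N _ ((M.encCfg_injective₁ N).injOn) (fun q a => if q = M.accept then ‖a‖ ^ 2 else 0)
    fun q => by simp

end subsingleton

/-! ### All well-formed machines: the head-centred step unitary -/

section all

variable (M : QTM) (N : ℕ) [NeZero N]

open Classical in
/-- **The head-centred step unitary of an arbitrary machine**: `hcStep` (local transition, shift,
erasure) over alphabets with at least two symbols, `hcStep₁` (`A ⊗ 1`) over one-symbol alphabets. For
every machine well formed in the tree's sense it is unitary and simulates the machine exactly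
(`hcUnitary_mem_unitaryGroup`, `acceptProbAt_eq_hcUnitary`). [cite: NishimuraOzawa2002, Thm. 4.3] -/
def hcUnitary : Matrix (M.HC N) (M.HC N) ℂ :=
  if Nontrivial M.Γ then M.hcStep N else M.hcStep₁ N

/-- Over alphabets with two symbols `hcUnitary = hcStep`. [folklore] -/
theorem hcUnitary_of_nontrivial [Nontrivial M.Γ] : M.hcUnitary N = M.hcStep N := by
  unfold hcUnitary
  rw [if_pos ‹Nontrivial M.Γ›]

/-- Over one-symbol alphabets `hcUnitary = hcStep₁`. [folklore] -/
theorem hcUnitary_of_subsingleton [Subsingleton M.Γ] : M.hcUnitary N = M.hcStep₁ N := by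
  unfold hcUnitary
  rw [if_neg (not_nontrivial M.Γ)]

/-- **Unitarity for every well-formed machine** (tree sense): by `isWellFormed_iff_isLocallyWellFormed`
over alphabets with two symbols and by `localSum_mem_unitaryGroup` over one-symbol alphabets.
[cite: NishimuraOzawa2002, Thm. 4.3] -/
theorem hcUnitary_mem_unitaryGroup (hwf : M.IsWellFormed) :
    M.hcUnitary N ∈ Matrix.unitaryGroup (M.HC N) ℂ := by
  rcases subsingleton_or_nontrivial M.Γ with hΓ | hΓ
  · rw [hcUnitary_of_subsingleton]
    exact M.hcStep₁_mem_unitaryGroup N hwf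
  · rw [hcUnitary_of_nontrivial]
    exact M.hcStep_mem_unitaryGroup N hwf.isLocallyWellFormed

/-- **Exact finite-dimensional unitary simulation of an arbitrary well-formed QTM in the tree's
(head-relative, translation-quotient) semantics.** For every `M` with `QTM.IsWellFormed M`, every input
`x`, time `t` and window size `N ≥ 2(|x| + t) + 3`:
`QTM.acceptProbAt M x t = ∑_{y : HC M N, y.state = accept} |(U^t |enc (init x)⟩)(y)|²` with
`U = hcUnitary M N` unitary, a product of three gates of fixed format acting on `O(1)` components
(`U_W`, `U_E`) and a controlled cyclic shift. This is the statement that the circuit side of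
`BQPQTM = BQP` (Yao 1993; Nishimura–Ozawa 2002, Thm. 4.3) needs for the tree's class `BQPQTM`
(`QuantumComplexity/QuantumTuring.lean`, S04, "Model caveat"): what remains is binary encoding of the
register into qubits, polynomial-time uniformity, polynomial-time computability of the gate entries
and gate compilation (`BQPOver_eq_BQP`). [cite: NishimuraOzawa2002, Thm. 4.3] -/
theorem acceptProbAt_eq_hcUnitary (hwf : M.IsWellFormed) (x : List Bool) (t : ℕ)
    (hN : 2 * (x.length + t) + 3 ≤ N) :
    M.acceptProbAt x t = ∑ y : M.HC N,
      if y.1 = M.accept then ‖((M.hcUnitary N) ^ t *ᵥ Pi.single (M.encCfg N (M.init x)) 1) y‖ ^ 2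
      else 0 := by
  rcases subsingleton_or_nontrivial M.Γ with hΓ | hΓ
  · rw [hcUnitary_of_subsingleton]
    exact M.acceptProbAt_eq_hcStep₁ N x t
  · rw [hcUnitary_of_nontrivial]
    exact M.acceptProbAt_eq_hcStep N hwf.isLocallyWellFormed x t hN

end all

end QTM

end Literature.Computability.Cryptography

end
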